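import Mathlib
import HarnessLib
import HarnessLib.Audit
import Summits.Langlands.Statement
import Literature.FieldTheory.AlgClosed.PadicAlgClEquivComplex
import Literature.NumberTheory.PAdicHodge.FontaineDpst
import Summits.Langlands.Langlands.Theorems.EisensteinDegreeShiftSectorComplementStubAvatarConjugacy
import Literature.NumberTheory.Automorphic.LocalLanglandsGLProofs
import Literature.NumberTheory.Automorphic.LocalConstantsProofs
import Literature.NumberTheory.Automorphic.InfinityTypeAutomorphicInduction
import Literature.NumberTheory.Automorphic.WeaklyRegularGaloisRep
import Literature.NumberTheory.EllipticCurves.FramedTateGaloisRep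
import Literature.NumberTheory.GaloisRepresentations.ResidualGaloisRep
import Literature.NumberTheory.GaloisRepresentations.AbsGaloisGroup
import Literature.NumberTheory.GaloisRepresentations.ContinuousRep
import Summits.Langlands.Langlands.Theorems.RootDecomp1RestrictionTwistTransport
import Summits.Langlands.Langlands.Theorems.RootDecomp1InductionTransport
import HarnessLib.Audit.Status.Attr

/-!
Route: PrimitiveRankLadder

# Route PrimitiveRankLadder — reciprocity's FM–Langlands core graded by rank, quotiented by
twist-primitivity (1 | 2 | ≥3 + cyclic-induction transport)

X = the frame of record N0 (route-Langlands-PrimeSwitchSplit rev 4: W⁺ ∧ P ∧ B_w ∧ L∤R ∧ CRD, with U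
= AvatarConjugacy proved) in which the
core B_w = WeakGeometricAutomorphy (stmt-Langlands-17414, Fontaine–Mazur–Langlands in weak a.e.
form) is replaced by its EXACT split along the
RANK ladder quotiented by twist-primitivity: B_w ⟺ RankOneAutomorphy ∧ RankTwoPrimitiveAutomorphy ∧
HigherRankPrimitiveAutomorphy ∧
CyclicInductionTransport (root decomposition cell decomp-langlands, lens «grading ladder», gen 0;
node file
HOME/nodes/lens-1-g0-PrimitiveRankLadder.lean proves the equivalence and `closes`). The two OPEN new
pieces are the primitive (no self-twist
ρ ≅ ρ ⊗ η, η ≠ 1) irreducible geometric ρ of rank 2, resp. of rank ≥ 3; rank 1 and the cyclically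
induced ρ are theorems in print
(CFT/Weil/Serre; Arthur–Clozel automorphic induction) fed by strong induction on the rank. U =
AvatarConjugacy (stmt-Langlands-17844) is
PROVED in the tree and consumed inside `closes` as the theorem
`Theorems.EisensteinDegreeShiftSectorComplement.stub_avatarConjugacy` (not re-filed).
No idea card realised (cell output).
LINEAGE: NODE decomp-langlands-lens-1-g0 2026-08-30T01:30:13Z
(nodes/lens-1-g0-PrimitiveRankLadder.lean sha256 076c0f76…; v2 2026-08-30T01:40:03Z
sha256 99b845d9…, linter-only change), CLEARED by decomp-langlands-crit-1 2026-08-30T01:33:42Z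
(HOME/CRITIC-LEDGER.md row 4: TARGET = typed ROOT;
EXACT AND-split of B_w, 0 EQUIV; answers the critic's OBJECTION 01:15:58Z to the bare rank axis
«RankOne ∧ HigherRank» of the writer frame; junk
test on `HasSelfTwist` passed; HigherRank-vs-RankTwo WEAKER with an UNDECIDED test recorded). Filed
by the cell writer (writer-1 gen 0) as a
SIBLING root decomposition of RootDecomp1 / ResidualSplit / WeightMultiplicitySplit sharing N0's
items by signature dedup (D-0019: an alternative
decomposition of the same node is a separate route, never a rival family inside one route); census
HOME/census/COSTUME-CENSUS-v1.md sha256 4dd86a1c….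
Lean: `RankOneAutomorphy ∧ RankTwoPrimitiveAutomorphy ∧ HigherRankPrimitiveAutomorphy ∧
CyclicInductionTransport ∧ SatakeAvatarExistence ∧ PadicMemberCompatibility ∧
CompatibilityAwayFromLR ∧ CanonicalReciprocityData`

## Assembly
Level 2: B_w at every rank by strong induction on n — n = 1 is RankOneAutomorphy; a ρ with
self-twist and n ≥ 2 is CyclicInductionTransport fed
by the induction hypothesis; a twist-primitive ρ is RankTwoPrimitiveAutomorphy (n = 2) or
HigherRankPrimitiveAutomorphy (n ≥ 3). Level 1 = N0's
assembly verbatim (prime switch ℓ' ∈ {2,3}, avatar transport through P, uniqueness from U = the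
landed theorem `stub_avatarConjugacy`). Pure
logic over the items; `closes` in glue.lean (certified by `ledger route check --native`) proves
`Assembly` first and applies it — all 8 binders used,
5 of them open cruxes.

Rationale: WHY THIS LINE. On the bare rank ladder every threshold is a costume: the tail B_w[n ≥ N] contains
the induced objects ρ ⊗ Ind χ of every lower-rank ρ and
Arthur–Clozel Ch. 3 Thm 4.2(b) (tree fact `ArthurClozel1989_inducedLift_of_twist_eq`) lets the tail
see all lower grades (crit-1 OBJECTION on
the writer frame: HigherRank ≡ B_w mod RankOne). Grading only the TWIST-PRIMITIVE part repairs this: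
`¬ HasSelfTwist ρ` (no rank-one η,
non-trivial at infinitely many places, with Frobenius charpolys stable under scaling by η(Frob_v)
a.e.; = not cyclically induced, Clifford)
removes exactly the induced objects from grades ≥ 2, and they are discharged by the theorem of
cyclic automorphic induction (ArthurClozel1989
Ch. 3 Thm 6.2 / Lemma 6.4, Henniart2012; tree facts
`automorphicInduction_cyclic_cuspidal(_unramified)`,
`Henniart2012_infinityType_of_automorphicInduction`).
Mod print B_w ≡ (rank-2 primitive) ∧ (rank ≥ 3 primitive): printed transfers out of rank 2 (Sym^m,
⊠, ∧², Asai) only raise the rank, and the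
one printed de-lifting (automorphy of ad⁰ρ₂ ⇒ automorphy of ρ₂: Calegari arXiv:0907.3427 p.7 via
Ramakrishnan 2014 doi:10.1007/s13226-014-0088-1)
needs a regular algebraic GL₃ form and Galois representations for the descended GL₂ form, so it
never reaches the open grade-2 core (even,
HT-irregular, mixed signature). Imported area: Clifford theory / the solvable (cyclic-layer)
trace-formula technology as the TRANSPORT, so that
the cut runs along `Literature.Barriers.Langlands.SolvableImageBarrier` instead of across it. No
prior route or negative grades the root by rank.

RANKED CRUXES. #2 RankTwoPrimitiveAutomorphy (crux) — Weak (a.e. Satake–Frobenius) automorphy of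
every irreducible pinned-geometric ℓ-adic ρ of rank 2 over any number field WITHOUT self-twist
(non-dihedral): an L-algebraic cuspidal π on GL₂ matching ρ at almost all places. Houses the live
rank-2 routes as sectors (SqrtFiveQuarticCovers 17832, SkinnerWilesDefectOne 12918, EvenArtin*
2903/2905); dihedral ρ go to CyclicInductionTransport. TAGS (crit-1 CLEARED 2026-08-30T01:33:42Z,
row 4; census sha256 4dd86a1c…): WEAKER(kernel `weakGeometricAutomorphy_iff_pieces` in the node
file; omits rank ≠ 2 and every self-twisted ρ) · OPEN · leaf INSTRUMENTABLE[sectors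
closed-mod-print: FM GL₂/ℚ odd (Kisin2009FontaineMazur, KhareWintenberger2009,
Pan2022LocallyAnalytic), TR ρ_E (FreitasLeHungSiksek2015; SqrtFiveQuarticCovers 17832),
SkinnerWilesDefectOne 12918, EvenArtin 2903–2905 — cite the items, do not re-type] · residual
IDEA-NEEDED (even infinite image, HT-irregular CM, mixed signature) ·
BARRIER(`ShimuraVarietyRealizationBarrier_holds`, `NonRegularWeightBarrier_holds`,
`ResiduallyReducibleBarrier_holds`, `SolvableImageBarrierNarrow_holds`). [difficulty: open-problem]
(why it might fail: even rank-2 ρ of infinite image over ℚ, HT-irregular ρ over CM fields and any ρ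
over mixed-signature K have no known automorphic construction (even Fontaine–Mazur; no Shimura
variety); one non-automorphic geometric ρ₂ refutes it.) [arXiv:0907.3427, Kisin2009FontaineMazur,
KhareWintenberger2009, Pan2022LocallyAnalytic, FreitasLeHungSiksek2015]
#3 HigherRankPrimitiveAutomorphy (crux) — Weak automorphy of every irreducible pinned-geometric
ℓ-adic ρ of rank n ≥ 3 over any number field WITHOUT self-twist (not cyclically induced): the
residual of the ladder. Strictly weaker than B_w is UNDECIDED with test «a printed de-symmetrisation
of WEAK automorphy Sym²ρ₂ ⇒ ρ₂ in the open grade-2 core»; instrumentable sub-sector: regular,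
polarizable, residually adequate and residually automorphic (BLGGT Thm 4.2.1), CM non-polarizable
(ACC+ Thm 6.1.1). TAGS (crit-1 CLEARED 2026-08-30T01:33:42Z, row 4): WEAKER than S; vs
RankTwoPrimitiveAutomorphy UNDECIDED[test: «Ad ρ₂ weakly automorphic ⇒ ρ₂ ⊗ χ weakly automorphic for
some Hecke χ, for non-cohomological primitive ρ₂» — not in print (crit-1 re-ran it: sign-spread
needs ρ_{π₂}; the ⊗-auxiliary route dies on GL₆ zeros = CPSConverseGL1 18579); if it lands, re-cut
by functorial primitivity] · OPEN · IDEA-NEEDED · leaf INSTRUMENTABLE sub-sector [BLGGT2014 Thm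
4.2.1, ACCGHLNSTT2023 Thm 6.1.1] · BARRIER(`TwistedEndoscopySelfDual_holds`,
`TaylorWilesNumericalCoincidence_holds`, `NonRegularWeightBarrier_holds`,
`ShimuraVarietyRealizationBarrier_holds`). [difficulty: open-problem] (why it might fail: for
non-polarizable or residually inadequate ρ of rank ≥ 3 over a general number field only automorphy
LIFTING / potential automorphy exist (twisted-endoscopy self-duality, Taylor–Wiles numerical
coincidence); a single non-automorphic primitive geometric ρ₃ refutes it.) [ClozelHarrisTaylor2008,
BLGGT2014, ACCGHLNSTT2023, doi:10.1007/s13226-014-0088-1]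
#4 SatakeAvatarExistence (crux) — N0 item stmt-Langlands-17415 verbatim (W⁺: every L-algebraic
cuspidal π on GL_n over any number field has an irreducible ℓ-adic avatar matching its Satake
parameters a.e., for every ℓ, ι) — cited by id, attached by signature dedup, not re-typed.
[difficulty: open-problem] (why it might fail: Galois representations for non-cohomological π (Maass
forms of eigenvalue 1/4, π over mixed-signature fields) and irreducibility of r_π for n ≥ 3 are
open; no cohomological realisation of π_f is known there.) [HarrisLanTaylorThorneRMS2016,
Scholze2015, BuzzardGeeLMS2014]
#5 PadicMemberCompatibility (crux) — N0 item stmt-Langlands-17534 verbatim (P: de Rham-ness at v ∣ ℓ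
of the weakly associated avatar and transport of local–global compatibility at v ∣ ℓ from an ℓ'-adic
member, ℓ' ∉ v) — cited by id. [difficulty: open-problem] (why it might fail: p-adic local–global
compatibility (de Rham-ness and WD-matching at v ∣ ℓ) is known only for regular polarizable /
Shimura-type avatars (Caraiani, BLGGT); torsion-class avatars (Scholze) lack it in general.)
[Caraiani2014, BLGGT2014, ACCGHLNSTT2023]
#6 CompatibilityAwayFromLR (crux) — N0 item stmt-Langlands-18084 verbatim (L∤R: full local–global
compatibility at every v ∤ ℓ for a weakly associated geometric avatar) — cited by id; its registered
split (SemisimpleMatchingOneDatum / MonodromyUpgrade) stacks unchanged. [difficulty: open-problem]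
(why it might fail: the monodromy operator at v ∤ ℓ is not controlled by a.e. Satake data for
non-Shimura avatars (MonodromyNotClosedUnderPadicLimits); Varma-type results need regular algebraic
polarizable π.) [Varma2024, TaylorYoshida2007, Caraiani2012]
#9 RankOneAutomorphy (support) — Grade 1 of the ladder: every (irreducible) pinned-geometric ℓ-adic
character of Γ_K is weakly automorphic (an L-algebraic Hecke character matching a.e.). Verbatim the
registered stub_rankOne (Cruxes/SectorComplement/Lines/birth_WeakGeometricAutomorphy.lean); print:
class field theory + Weil 1956 + Serre 1968 III.2.3 + abelian Fontaine–Mazur. TAGS: WEAKER · PRINT ·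
ATTACKABLE[closed-mod-print; = the registered `stub_rankOne` verbatim — one proof closes both].
[difficulty: provable-now] [Serre1968AbelianEllAdic, Weil1956Hecke]
#9 CyclicInductionTransport (support) — The inductive step of the ladder, isolated: for an
irreducible pinned-geometric ρ of rank n ≥ 2 WITH a self-twist, weak automorphy at all ranks m < n
(over all number fields) implies weak automorphy of ρ — Clifford (ρ ≅ Ind_E σ, E/K cyclic of prime
degree) + cyclic automorphic induction in Satake form (Arthur–Clozel Ch. 3 Thm 6.2, Lemma 6.4;
Henniart 2012 at ∞); tree facts automorphicInduction_cyclic_cuspidal(_unramified),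
Henniart2012_infinityType_of_automorphicInduction,
ArthurClozel1989_automorphicInduction_of_selfTwist,
FramedGaloisRep.nonempty_equiv_of_hasFrobCharpolyAt_eventually. TAGS: WEAKER · PRINT (given all
lower grades) · ATTACKABLE[closed-mod-print: theorem
`FramedGaloisRep.nonempty_equiv_of_hasFrobCharpolyAt_eventually` (Chebotarev–Brauer–Nesbitt),
Clifford, the AI Prop-facts and Henniart's archimedean theorems named above]. [difficulty: M]
[ArthurClozel1989, Henniart2012]
#9 CanonicalReciprocityData (support) — N0 item stmt-Langlands-17930 verbatim (CRD: every number
field carries a reciprocity datum) — cited by id; closed-mod-print (Harris–Taylor local reciprocity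
+ Fontaine period rings). [difficulty: provable-now] [HarrisTaylor2001, Fontaine1994]

TWO-LAYER PLAN. RankTwoPrimitiveAutomorphy ⇐ (K totally real ∨ CM, HT-regular) ∧ (open core: even /
HT-irregular / mixed signature) once a typed archimedean-parity
datum exists (lens-2's D1/D2); HigherRankPrimitiveAutomorphy ⇐ (residually automorphic ∧ adequate:
automorphy lifting, closed-mod-print BLGGT 4.2.1)
∧ (residual automorphy: Serre-type, open) — i.e. lens-3's residual split applied inside grade ≥ 3.
Nothing filed now.

KILL CRITERIA. A refutation of RankTwoPrimitiveAutomorphy or HigherRankPrimitiveAutomorphy (a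
non-automorphic irreducible geometric primitive ρ) refutes B_w and
hence the summit's (B) direction as typed — it would close the summit negatively, not just this
route. A proof that `HasSelfTwist` as typed is
satisfied by every ρ (or by none) kills the SPLIT (pieces vacuous / transport vacuous): pivot to the
finite-order-Hecke-character phrasing.
A printed theorem «weak automorphy of Sym²ρ₂ ⇒ weak automorphy of ρ₂» for the open grade-2 core
would make HigherRankPrimitiveAutomorphy ≡ B_w
mod print (costume): pivot to functorial primitivity (exclude images of Sym^m / ⊠ / ∧² as well).

NOT DECOMPOSED YET. Field type (TR/CM vs mixed signature), Hodge–Tate regularity and residual image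
inside each grade — these are the sector hypotheses of the live
rank-2 routes and of the lifting theorems; they become layer-2 children only with typed
archimedean/parity data. Functorial primitivity
(Zariski-closure conditions) is deliberately not typed in gen 0.

CHEAPEST FALSIFIER. Vacuity of the new predicate: exhibit in Lean that `HasSelfTwist ρ` holds for
all ρ or for no ρ as typed (probes file: simp/tauto/aesop
batteries fail on both `AllSelfTwist` and `NoSelfTwist`; by hand: P = 0 is excluded because
Frobenius charpolys have non-zero constant term, and
an η of infinite order cannot stabilise a charpoly unless η(Frob_v) is an n!-th root of unity a.e.).
Second: `lean check` of the node file (done: rc 0, 0 sorry).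

NUMBERS. Grades: n = 1 (print), n = 2 (automorphy known for K = ℚ odd — Kisin 2009 /
Khare–Wintenberger 2009 / Pan 2022; TR elliptic curves — FLHS 2015),
n ≥ 3 (only automorphy lifting / potential automorphy: CHT 2008, BLGGT 2014 Thm 4.2.1, ACC+ 2023 Thm
6.1.1).

DEFINITION REQUESTS. `HasSelfTwist` / `IsPinnedGeometric` / `WeakAutomorphyAtRank` are inlined in
the items (no new Literature notion needed); a named
`Summits/Langlands/Langlands/Theorems` vocabulary file with these three defs +
`weakGeometricAutomorphy_iff_pieces` is requested from the writer
when RootDecomp<k> is filed (text = HOME/nodes/lens-1-g0-PrimitiveRankLadder.lean ll. 50–110,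
180–192).

Novelty: Searches (2026-08-30): lit search --hybrid «selfdual cusp forms GL(3) adjoint lift Ramakrishnan» (8
book hits, none relevant); lit search --source all «Ramakrishnan exercise selfdual cusp forms GL(3)»
(6 local citing papers incl. paper:arxiv-0907.3427; zbMATH/crossref doi:10.1007/s13226-014-0088-1,
doi:10.1090/conm/655/13205); lit search «Sorensen patching lemma potential automorphy» (5 local); rg
over lean/Summits/Langlands (no HasSelfTwist / primitive / scaleRoots decl in any Theses file; rank
used only as N0 writer vocabulary RankOne ∧ HigherRank); tree AC library (40
ArthurClozel*/AutomorphicInduction* files) for the transport facts.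
Nearest prior art found: Calegari, Even Galois representations and the Fontaine–Mazur conjecture
(arXiv:0907.3427) p.7 — the rank-3 ⇒ rank-2 de-lifting via Ramakrishnan's GL(3) exercise in the
RAESDC sector; Arthur–Clozel 1989 Ch. 3 Thm 4.2(b)/6.2 — the induced locus is exactly what cyclic
base change/induction controls; writer frame nodes/writer-1-g0-PiecesAll.lean:169–195 (bare RankOne
∧ HigherRank, objected as costume).
Delta: grades the Fontaine–Mazur–Langlands core by rank on the TWIST-PRIMITIVE quotient, so that the
induced locus (the only channel through which a higher grade sees a lower one in print) is
discharged by a theorem and the two open grades have exclusive content.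
Claimed grade: new-combination  [refs: 10.1007/s13226-014-0088-1, 10.1090/conm/655/13205, 0907.3427, paper:arxiv-0907.3427, doi:10.1007/s13226-014-0088-1, doi:10.1090/conm/655/13205]

Barriers (technique_class: rank-induction, automorphic-induction, primitivity): - technique_class: rank-induction, automorphic-induction, primitivity
- Literature.Barriers.Langlands.SolvableImageBarrier: the transport piece sits INSIDE its class
(cyclic layers) and is exactly what the class proves (AC III.6); the two primitive cruxes sit
OUTSIDE it by definition (¬HasSelfTwist = no cyclic-induction layer) — the cut runs along the
barrier; the bet is not that solvable technology reaches primitive ρ (it does not).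
- Literature.Barriers.Langlands.TwistedEndoscopySelfDual: applies to HigherRankPrimitiveAutomorphy
(potential automorphy needs polarizable ρ); it does not evade it; the bet is the ACC+ non-self-dual
technology over CM fields plus a new idea off CM.
- Literature.Barriers.Langlands.TaylorWilesNumericalCoincidence: applies to both open grades off
totally real/CM fields (no patching with l₀ > 0 beyond Calegari–Geraghty); not evaded; recorded as
BARRIER leaf.
- Literature.Barriers.Langlands.ShimuraVarietyRealizationBarrier: applies to the mixed-signature
part of grade 2 and to W⁺; not evaded.
- Literature.Barriers.Langlands.NonRegularWeightBarrier: applies to the HT-irregular part of both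
grades; not evaded (lens-2's weight cut is the orthogonal axis).
- Literature.Barriers.Langlands.ResiduallyReducibleBarrier: applies inside both grades (residually
reducible ρ); sector routes (SkinnerWilesDefectOne) attack it; not evaded globally.
- Literature.Barriers.Langlands.SolvableImageBarrierNarrow: `SolvableImageBarrierNarrow_holds`
bounds chains of base chan

History (route lifecycle, newest last):
- 2026-08-30T12:35:42Z · rev 3: restated SatakeAvatarExistence_of_split (stmt-Langlands-32396 proved) — render-order workaround step 1/2 before the lens-1-g10 InverseInductionLadder --resplit of SatakeAvatarExistence (crit-1 row 117 CLEARED): the g9 glue SatakeAva (planner-decomp-langlands-writer-1-g3-0)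
- 2026-08-30T12:37:32Z · rev 3: restated SatakeAvatarExistence_of_split (stmt-Langlands-32396 proved) — render-order workaround step 1/2 before the lens-1-g10 InverseInductionLadder --resplit of SatakeAvatarExistence (crit-1 row 117 CLEARED): the g9 glue SatakeAva (planner-decomp-langlands-writer-1-g3-0)
- 2026-08-30T12:39:27Z · rev 3: restated SatakeAvatarExistence_of_split (stmt-Langlands-32396 proved) — render-order workaround step 1/2 before the lens-1-g10 InverseInductionLadder --resplit of SatakeAvatarExistence (crit-1 row 117 CLEARED): the g9 glue SatakeAva (planner-decomp-langlands-writer-1-g3-0)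
- 2026-08-30T13:39:27Z · rev 5: restated SatakeAvatarExistence_of_split3 (stmt-Langlands-33226 proved) — render-order workaround step 1/2 (writer-1-g4 under tenure) before the lens-1-g11 WeaklyRegularInductionLadder gen-3 --resplit of SatakeAvatarExistence (NODE L5 (planner-decomp-langlands-writer-1-g4-0)
- 2026-08-30T14:12:53Z · rev 7: restated SatakeAvatarExistence_of_split4 (stmt-Langlands-33427 proved) — render-order workaround before the gen-4 resplit (lens-1-g12 TowerInductionLadder, crit-1 g4 CLEARED row 135 advisory a1 = case (b): glue item 33427 is CLOSED p (planner-decomp-langlands-writer-1-g4-0)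
- 2026-08-30T14:13:07Z · rev 7: restated SatakeAvatarExistence_of_split4 (stmt-Langlands-33427 proved) — render-order workaround before the gen-4 resplit (lens-1-g12 TowerInductionLadder, crit-1 g4 CLEARED row 135 advisory a1 = case (b): glue item 33427 is CLOSED p (planner-decomp-langlands-writer-1-g4-0)
- 2026-08-30T14:13:19Z · rev 7: restated SatakeAvatarExistence_of_split4 (stmt-Langlands-33427 proved) — render-order workaround before the gen-4 resplit (lens-1-g12 TowerInductionLadder, crit-1 g4 CLEARED L661 row 135 advisory a1 = case (b): glue item 33427 is CLO (planner-decomp-langlands-writer-1-g4-0)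
- 2026-08-30T14:14:39Z · rev 7: restated SatakeAvatarExistence_of_split4 (stmt-Langlands-33427 proved) — render-order workaround before the gen-4 resplit (lens-1-g12 TowerInductionLadder, crit-1 g4 CLEARED L661 row 135 advisory a1 = case (b): glue item 33427 is CLO (planner-decomp-langlands-writer-1-g4-0)

sub-problem: Langlands · status: draft · opened planner-decomp-langlands-writer-1-g0-0 2026-08-30T02:05:02Z · rev 8 · ledger route-Langlands-PrimitiveRankLadder
GENERATED by the gate from the ledger (D-0016/17). Provers cite these decls: `theorem foo : Summit.Langlands.Langlands.Theses.PrimitiveRankLadder.<Decl> := …` in Summits/Langlands/Langlands/Theorems/<Name>.lean.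
-/

namespace Summit.Langlands.Langlands.Theses.PrimitiveRankLadder

open scoped BigOperators Topology Manifold Classical MeasureTheory ProbabilityTheory Matrix InnerProductSpace ComplexConjugate ContinuousMap
open Filter Set Function TopologicalSpace MeasureTheory

attribute [summit_statement] _root_.Langlands

/-! Retired items kept as plain definitions (history; not obligations of this route): landed proofs / closed glue still name them. -/

/-- retired stmt-Langlands-29150 (retired, gen 2) — proved by Summit.Langlands.Langlands.Theorems.restrictionTwistTransport_rootDecomp1. -/
def RestrictionTwistTransport : Prop :=
  ∀ (K₀ : Type) [Field K₀] [NumberField K₀] (M : Type) [Field M] [NumberField M] [Algebra K₀ M] (n : ℕ) (h₀ : Literature.NumberTheory.Automorphic.isCompact_glFiniteIntegralLevel n K₀) (hM : Literature.NumberTheory.Automorphic.isCompact_glFiniteIntegralLevel n M) (h₁ : Literature.NumberTheory.Automorphic.isCompact_glFiniteIntegralLevel 1 M), 0 < n → ∀ (π₀ : Literature.NumberTheory.Automorphic.CuspidalAutomorphicRepData n K₀ h₀) (χ : Literature.NumberTheory.Automorphic.AutomorphicRepData (Literature.NumberTheory.Automorphic.AutomorphyDatum.gl 1 M h₁)) (P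 : Literature.NumberTheory.Automorphic.CuspidalAutomorphicRepData n M hM), π₀.1.IsLAlgebraic → χ.IsLAlgebraic → P.1.IsLAlgebraic → (∀ᶠ w : IsDedekindDomain.HeightOneSpectrum (NumberField.RingOfIntegers M) in cofinite, ∀ (u : IsDedekindDomain.HeightOneSpectrum (NumberField.RingOfIntegers K₀)) (α : Multiset ℂ) (c : ℂ), w.asIdeal.under (NumberField.RingOfIntegers K₀) = u.asIdeal → π₀.1.HasSatakeParamAt u α → χ.HasSatakeParamAt w {c} → P.1.HasSatakeParamAt w ((α.map (· ^ w.asIdeal.inertiaDeg (NumberField.RingOfIntegers K₀))).map (c * ·))) → ∀ (ℓ : ℕ) [Fact ℓ.Prime] (ι : PadicAlgCl ℓ ≃+* ℂ) (ρ₀ : Literature.NumberTheory.GaloisRepresentations.FramedGaloisRep K₀ (PadicAlgCl ℓ) n), ρ₀.toGaloisRep.IsSemisimple → (∀ᶠ u : IsDedekindDomain.HeightOneSpectrum (NumberField.RingOfIntegers K₀) in cofinite, SatakeFrobCompatibleAt ι π₀.1 ρ₀ u) → ∃ r : Literature.NumberTheory.GaloisRepresentations.FramedGaloisRep M (PadicAlgCl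 ℓ) n, r.toGaloisRep.IsSemisimple ∧ ∀ᶠ w : IsDedekindDomain.HeightOneSpectrum (NumberField.RingOfIntegers M) in cofinite, SatakeFrobCompatibleAt ι P.1 r w

/-- retired stmt-Langlands-29151 (retired, gen 2) — proved by Summit.Langlands.Langlands.Theorems.inductionTransport_proof. -/
def InductionTransport : Prop :=
  ∀ (K : Type) [Field K] [NumberField K] (L : Type) [Field L] [NumberField L] [Algebra K L] (m n : ℕ) (hL : Literature.NumberTheory.Automorphic.isCompact_glFiniteIntegralLevel m L) (hcpt : Literature.NumberTheory.Automorphic.isCompact_glFiniteIntegralLevel n K), 0 < m → 0 < n → ∀ (σ : Literature.NumberTheory.Automorphic.CuspidalAutomorphicRepData m L hL) (π : Literature.NumberTheory.Automorphic.CuspidalAutomorphicRepData n K hcpt), σ.1.IsLAlgebraic → π.1.IsLAlgebraic → (∀ᶠ v : IsDedekindDomain.HeightOneSpectrum (NumberField.RingOfIntegers K) in cofinite, ∀ β : IsDedekindDomain.HeightOneSpectrum (NumberField.RingOfIntegers L) → Multiset ℂ, (∀ w : IsDedekindDomain.HeightOneSpectrum (NumberField.RingOfIntegers L), w.asIdeal.under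 (NumberField.RingOfIntegers K) = v.asIdeal → σ.1.HasSatakeParamAt w (β w)) → ∃ α : Multiset ℂ, π.1.HasSatakeParamAt v α ∧ Literature.NumberTheory.Automorphic.satakePolynomial α = ∏ᶠ w ∈ {w : IsDedekindDomain.HeightOneSpectrum (NumberField.RingOfIntegers L) | w.asIdeal.under (NumberField.RingOfIntegers K) = v.asIdeal}, (Literature.NumberTheory.Automorphic.satakePolynomial (β w)).comp (Polynomial.X ^ w.asIdeal.inertiaDeg (NumberField.RingOfIntegers K))) → ∀ (ℓ : ℕ) [Fact ℓ.Prime] (ι : PadicAlgCl ℓ ≃+* ℂ) (r : Literature.NumberTheory.GaloisRepresentations.FramedGaloisRep L (PadicAlgCl ℓ) m), r.toGaloisRep.IsSemisimple → (∀ᶠ w : IsDedekindDomain.HeightOneSpectrum (NumberField.RingOfIntegers L) in cofinite, SatakeFrobCompatibleAt ι σ.1 r w) → ∃ ρ : Literature.NumberTheory.GaloisRepresentations.FramedGaloisRep K (PadicAlgCl ℓ) n, ρ.toGaloisRep.IsSemisimple ∧ ∀ᶠ v : IsDedekindDomain.HeightOneSpectrum (NumberField.RingOfIntegers K) in cofinite,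 SatakeFrobCompatibleAt ι π.1 ρ v

/-- item stmt-Langlands-24803 · crux · rank 2 · SPLIT (gen 1) into GenericEllipticAutomorphy, ExceptionalEllipticAutomorphy, NonEllipticRankTwoAutomorphy + glue RankTwoPrimitiveAutomorphy_of_split · direct attempts still welcome (low priority) · by planner
why it might fail: even rank-2 ρ of infinite image over ℚ, HT-irregular ρ over CM fields and any ρ over mixed-signature K have no known automorphic construction (even Fontaine–Mazur; no Shimura variety); one non-automorphic geometric ρ₂ refutes it.
sources: arXiv:0907.3427, Kisin2009FontaineMazur, KhareWintenberger2009, Pan2022LocallyAnalytic, FreitasLeHungSiksek2015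
[crux] Weak (a.e. Satake–Frobenius) automorphy of every irreducible pinned-geometric ℓ-adic ρ of
rank 2 over any number field WITHOUT self-twist (non-dihedral): an L-algebraic cuspidal π on GL₂
matching ρ at almost all places. Houses the live rank-2 routes as sectors (SqrtFiveQuarticCovers
17832, SkinnerWilesDefectOne 12918, EvenArtin* 2903/2905); dihedral ρ go to
CyclicInductionTransport. TAGS (crit-1 CLEARED 2026-08-30T01:33:42Z, row 4; census sha256
4dd86a1c…): WEAKER(kernel `weakGeometricAutomorphy_iff_pieces` in the node file; omits rank ≠ 2 and
every self-twisted ρ) · OPEN · leaf INSTRUMENTABLE[sectors closed-mod-print: FM GL₂/ℚ odd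
(Kisin2009FontaineMazur, KhareWintenberger2009, Pan2022LocallyAnalytic), TR ρ_E
(FreitasLeHungSiksek2015; SqrtFiveQuarticCovers 17832), SkinnerWilesDefectOne 12918, EvenArtin
2903–2905 — cite the items, do not re-type] · residual IDEA-NEEDED (even infinite image,
HT-irregular CM, mixed signature) · BARRIER(`ShimuraVarietyRealizationBarrier_holds`,
`NonRegularWeightBarrier_holds`, `ResiduallyReducibleBarrier_holds`,
`SolvableImageBarrierNarrow_holds`). [difficulty: open-problem] -/
@[route_item "route-Langlands-PrimitiveRankLadder", crux]
def RankTwoPrimitiveAutomorphy : Prop :=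
  ∀ (K : Type) [Field K] [NumberField K] (hcpt : Literature.NumberTheory.Automorphic.isCompact_glFiniteIntegralLevel 2 K) (ℓ : ℕ) [Fact ℓ.Prime] (ι : PadicAlgCl ℓ ≃+* ℂ) (ρ : Literature.NumberTheory.GaloisRepresentations.FramedGaloisRep K (PadicAlgCl ℓ) 2), ρ.toGaloisRep.IsIrreducible → ((∀ᶠ v : IsDedekindDomain.HeightOneSpectrum (NumberField.RingOfIntegers K) in Filter.cofinite, ρ.IsUnramifiedAt v) ∧ ∀ (v : IsDedekindDomain.HeightOneSpectrum (NumberField.RingOfIntegers K)) (hv : ((ℓ : ℕ) : NumberField.RingOfIntegers K) ∈ v.asIdeal), (Literature.NumberTheory.PAdicHodge.fontainePstAdicCompletion v ℓ hv).IsDeRhamFramed (ρ.toLocal v)) → ¬ (∃ η : Literature.NumberTheory.GaloisRepresentations.FramedGaloisRep K (PadicAlgCl ℓ) 1, (∃ᶠ v : IsDedekindDomain.HeightOneSpectrum (NumberField.RingOfIntegers K) in Filter.cofinite, ∃ a : PadicAlgCl ℓ, a ≠ 1 ∧ η.HasFrobCharpolyAt v (Polynomial.X - Polynomial.C a)) ∧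 ∀ᶠ v : IsDedekindDomain.HeightOneSpectrum (NumberField.RingOfIntegers K) in Filter.cofinite, ∃ (P : Polynomial (PadicAlgCl ℓ)) (a : PadicAlgCl ℓ), ρ.HasFrobCharpolyAt v P ∧ η.HasFrobCharpolyAt v (Polynomial.X - Polynomial.C a) ∧ P.scaleRoots a = P) → ∃ π : Literature.NumberTheory.Automorphic.CuspidalAutomorphicRepData 2 K hcpt, π.1.IsLAlgebraic ∧ ∀ᶠ v : IsDedekindDomain.HeightOneSpectrum (NumberField.RingOfIntegers K) in Filter.cofinite, SatakeFrobCompatibleAt ι π.1 ρ v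

-- parent: RankTwoPrimitiveAutomorphy · child (gen 1)
/--     item stmt-Langlands-30755 · crux · rank 202 · open
    parent: RankTwoPrimitiveAutomorphy · by planner
    why it might fail: Beyond half the gonality of the 3·5·7-exceptional curves there are infinitely many exceptional (K₀, j) in every large degree; closing them needs a NEW door (Serre's conjecture over totally real fields at p ≥ 11) — open; one non-modular exceptional curve over a sextic field refutes it.
    sources: FreitasLeHungSiksek2015, DerickxNajmanSiksek2020, Box2022, arXiv:2110.04078, arXiv:2206.12860, paper:arxiv-2304.09003 p.10
[crux · FINITE / LOW-COMPLEXITY RANGE of the switching engine · the ATTACKED conjunct ·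
INSTRUMENTABLE by degree] EXC — the same conclusion for the ρ that HAVE a totally real elliptic
witness (L, K₀, E, χ as in NonEllipticRankTwoAutomorphy, any degree of K₀) but NO 3–5–7-GENERIC one:
for every witness, the residual representation of the p-adic Tate module of E restricted to
Γ_{K₀(ζ_p)} (`(E.framedTateGaloisRep p).restrictField (CyclotomicField p K₀)`,
`IsResiduallyAbsIrreducible`) is absolutely REDUCIBLE for p = 3, 5 AND 7. By the subgroup trichotomy
in GL₂(𝔽_p) (FLS 2015 Prop. 12; DNS 2020 Prop. 2.1) such E are non-cuspidal K₀-points on the 27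
modular curves X(u,v,w) of genus > 1, so EXC is a diophantine statement graded by d = [K₀ : ℚ]: d ≤
3 PRINT (tree facts FLS2015_theorem1, DNS2020_theorem4), d = 4 PRINT off √5 (Box2022_theorem1_1) and
LIVE for √5 ∈ K₀ = SqrtFiveQuarticCovers.RefinedLocusModular stmt-Langlands-17833 (split into
certificates 23413–23417 — exactly this cell, curve by curve), d = 5 Ishitsuka–Ito–Yoshikawa 2022
Thm 1.2 (all but finitely many fields), d ≥ 6 cofinite in j per field (FLS2015_theorem5), finite
below half the gonality (Frey–Faltings); transport to ρ i -/
@[route_item "route-Langlands-PrimitiveRankLadder"]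
def ExceptionalEllipticAutomorphy : Prop :=
  ∀ (K : Type) [Field K] [NumberField K] (hcpt : Literature.NumberTheory.Automorphic.isCompact_glFiniteIntegralLevel 2 K) (ℓ : ℕ) [Fact ℓ.Prime] (ι : PadicAlgCl ℓ ≃+* ℂ) (ρ : Literature.NumberTheory.GaloisRepresentations.FramedGaloisRep K (PadicAlgCl ℓ) 2), ρ.toGaloisRep.IsIrreducible → ((∀ᶠ v : IsDedekindDomain.HeightOneSpectrum (NumberField.RingOfIntegers K) in Filter.cofinite, ρ.IsUnramifiedAt v) ∧ ∀ (v : IsDedekindDomain.HeightOneSpectrum (NumberField.RingOfIntegers K)) (hv : ((ℓ : ℕ) : NumberField.RingOfIntegers K) ∈ v.asIdeal), (Literature.NumberTheory.PAdicHodge.fontainePstAdicCompletion v ℓ hv).IsDeRhamFramed (ρ.toLocal v)) → ¬ (∃ η : Literature.NumberTheory.GaloisRepresentations.FramedGaloisRep K (PadicAlgCl ℓ) 1, (∃ᶠ v : IsDedekindDomain.HeightOneSpectrum (NumberField.RingOfIntegers K) in Filter.cofinite, ∃ a : PadicAlgCl ℓ, a ≠ 1 ∧ η.HasFrobCharpolyAt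 v (Polynomial.X - Polynomial.C a)) ∧ ∀ᶠ v : IsDedekindDomain.HeightOneSpectrum (NumberField.RingOfIntegers K) in Filter.cofinite, ∃ (P : Polynomial (PadicAlgCl ℓ)) (a : PadicAlgCl ℓ), ρ.HasFrobCharpolyAt v P ∧ η.HasFrobCharpolyAt v (Polynomial.X - Polynomial.C a) ∧ P.scaleRoots a = P) → ((∃ (L : Type) (_ : Field L) (_ : NumberField L) (_ : Algebra K L), IsGalois K L ∧ IsSolvable (L ≃ₐ[K] L) ∧ ∃ (K₀ : Type) (_ : Field K₀) (_ : NumberField K₀) (_ : Algebra K₀ L), IsGalois K₀ L ∧ IsSolvable (L ≃ₐ[K₀] L) ∧ NumberField.IsTotallyReal K₀ ∧ ∃ (E : WeierstrassCurve K₀) (_ : E.IsElliptic) (χ : Literature.NumberTheory.GaloisRepresentations.FramedGaloisRep L (PadicAlgCl ℓ) 1), (∀ g : Field.absoluteGaloisGroup L, Literature.NumberTheory.GaloisRepresentations.FramedRep.trace (ρ.restrictField L) g = Literature.NumberTheory.GaloisRepresentations.FramedRep.trace χ g * Literature.NumberTheory.GaloisRepresentations.FramedRep.trace ((E.framedTateGaloisRep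 ℓ).restrictField L) g)) ∧ ¬ (∃ (L : Type) (_ : Field L) (_ : NumberField L) (_ : Algebra K L), IsGalois K L ∧ IsSolvable (L ≃ₐ[K] L) ∧ ∃ (K₀ : Type) (_ : Field K₀) (_ : NumberField K₀) (_ : Algebra K₀ L), IsGalois K₀ L ∧ IsSolvable (L ≃ₐ[K₀] L) ∧ NumberField.IsTotallyReal K₀ ∧ ∃ (E : WeierstrassCurve K₀) (_ : E.IsElliptic) (χ : Literature.NumberTheory.GaloisRepresentations.FramedGaloisRep L (PadicAlgCl ℓ) 1), (∀ g : Field.absoluteGaloisGroup L, Literature.NumberTheory.GaloisRepresentations.FramedRep.trace (ρ.restrictField L) g = Literature.NumberTheory.GaloisRepresentations.FramedRep.trace χ g * Literature.NumberTheory.GaloisRepresentations.FramedRep.trace ((E.framedTateGaloisRep ℓ).restrictField L) g) ∧ (∃ (p : ℕ) (_ : Fact p.Prime), (p = 3 ∨ p = 5 ∨ p = 7) ∧ ((E.framedTateGaloisRep p).restrictField (CyclotomicField p K₀)).IsResiduallyAbsIrreducible))) → ∃ π : Literature.NumberTheory.Automorphic.CuspidalAutomorphicRepData 2 K hcpt,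 π.1.IsLAlgebraic ∧ ∀ᶠ v : IsDedekindDomain.HeightOneSpectrum (NumberField.RingOfIntegers K) in Filter.cofinite, SatakeFrobCompatibleAt ι π.1 ρ v

-- parent: RankTwoPrimitiveAutomorphy · child (gen 1)
/--     item stmt-Langlands-30756 · crux · rank 203 · open
    parent: RankTwoPrimitiveAutomorphy · by planner
    why it might fail: Even rank-2 ρ of infinite image over ℚ, HT-irregular ρ over CM/TR fields, ρ over mixed-signature K and GL₂-type abelian varieties over general K have no automorphic construction (no Shimura variety, no R=T at irregular weight); one non-automorphic geometric ρ₂ refutes it.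
    sources: arXiv:0907.3427, Kisin2009FontaineMazur, Pan2022LocallyAnalytic, Literature.Barriers.Langlands.NonRegularWeight, Literature.Barriers.Langlands.ShimuraVarietyRealization
[crux · DARK COMPLEMENT of the switching engine · DECLARED RESIDUAL of the split · IDEA-NEEDED ·
BARRIER NonRegularWeightBarrier ∧ ShimuraVarietyRealizationBarrier ∧ ResiduallyReducibleBarrier
(inherited)] REST — weak automorphy (L-algebraic cuspidal π on GL₂/K, Satake–Frobenius compatible
a.e.) of every irreducible, pinned-geometric, twist-primitive ρ : Γ_K → GL₂(ℚ̄_ℓ) that has NO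
TOTALLY REAL ELLIPTIC WITNESS of any degree: no finite L, Galois with solvable group over K and over
a totally real K₀ ⊆ L, elliptic curve E/K₀ and character χ of Γ_L with tr ρ|Γ_L = tr χ · tr
ρ_{E,ℓ}|Γ_L (ρ_{E,ℓ} = the tree's constructed Tate-module representation
`WeierstrassCurve.framedTateGaloisRep`). Contents: Hodge–Tate weights not a twist of {0,1} at some
label (classical weight ≥ 3, partial weight one, Maass type), GL₂-type of dimension ≥ 2 after every
solvable sandwich, even ρ, curves over fields not solvably commensurable with a totally real field
of definition (census v8 AT3). Orbit-closed (∃ over sandwiches; perfect-core lemma). STRICTLY inside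
lens-1 g7's OFF (kernel nonElliptic_of_offLadder in the node): = its foreseen «NonEllipticRankTwo»
box typed. TAGS (crit-1 CLEARED 2026-08-30T07:58:26 -/
@[route_item "route-Langlands-PrimitiveRankLadder"]
def NonEllipticRankTwoAutomorphy : Prop :=
  ∀ (K : Type) [Field K] [NumberField K] (hcpt : Literature.NumberTheory.Automorphic.isCompact_glFiniteIntegralLevel 2 K) (ℓ : ℕ) [Fact ℓ.Prime] (ι : PadicAlgCl ℓ ≃+* ℂ) (ρ : Literature.NumberTheory.GaloisRepresentations.FramedGaloisRep K (PadicAlgCl ℓ) 2), ρ.toGaloisRep.IsIrreducible → ((∀ᶠ v : IsDedekindDomain.HeightOneSpectrum (NumberField.RingOfIntegers K) in Filter.cofinite, ρ.IsUnramifiedAt v) ∧ ∀ (v : IsDedekindDomain.HeightOneSpectrum (NumberField.RingOfIntegers K)) (hv : ((ℓ : ℕ) : NumberField.RingOfIntegers K) ∈ v.asIdeal), (Literature.NumberTheory.PAdicHodge.fontainePstAdicCompletion v ℓ hv).IsDeRhamFramed (ρ.toLocal v)) → ¬ (∃ η : Literature.NumberTheory.GaloisRepresentations.FramedGaloisRep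 K (PadicAlgCl ℓ) 1, (∃ᶠ v : IsDedekindDomain.HeightOneSpectrum (NumberField.RingOfIntegers K) in Filter.cofinite, ∃ a : PadicAlgCl ℓ, a ≠ 1 ∧ η.HasFrobCharpolyAt v (Polynomial.X - Polynomial.C a)) ∧ ∀ᶠ v : IsDedekindDomain.HeightOneSpectrum (NumberField.RingOfIntegers K) in Filter.cofinite, ∃ (P : Polynomial (PadicAlgCl ℓ)) (a : PadicAlgCl ℓ), ρ.HasFrobCharpolyAt v P ∧ η.HasFrobCharpolyAt v (Polynomial.X - Polynomial.C a) ∧ P.scaleRoots a = P) → ¬ (∃ (L : Type) (_ : Field L) (_ : NumberField L) (_ : Algebra K L), IsGalois K L ∧ IsSolvable (L ≃ₐ[K] L) ∧ ∃ (K₀ : Type) (_ : Field K₀) (_ : NumberField K₀) (_ : Algebra K₀ L), IsGalois K₀ L ∧ IsSolvable (L ≃ₐ[K₀] L) ∧ NumberField.IsTotallyReal K₀ ∧ ∃ (E : WeierstrassCurve K₀) (_ : E.IsElliptic) (χ : Literature.NumberTheory.GaloisRepresentations.FramedGaloisRep L (PadicAlgCl ℓ) 1), (∀ g : Field.absoluteGaloisGroup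 L, Literature.NumberTheory.GaloisRepresentations.FramedRep.trace (ρ.restrictField L) g = Literature.NumberTheory.GaloisRepresentations.FramedRep.trace χ g * Literature.NumberTheory.GaloisRepresentations.FramedRep.trace ((E.framedTateGaloisRep ℓ).restrictField L) g)) → ∃ π : Literature.NumberTheory.Automorphic.CuspidalAutomorphicRepData 2 K hcpt, π.1.IsLAlgebraic ∧ ∀ᶠ v : IsDedekindDomain.HeightOneSpectrum (NumberField.RingOfIntegers K) in Filter.cofinite, SatakeFrobCompatibleAt ι π.1 ρ v

-- parent: RankTwoPrimitiveAutomorphy · child (gen 1)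
/--     item stmt-Langlands-30754 · support · rank 201 · open
    parent: RankTwoPrimitiveAutomorphy · by planner
    why it might fail: Only via the transport: identifying the cyclic descents L ↝ K of the base-changed Hilbert form with ρ needs Galois representations over the intermediate (possibly mixed-signature) fields — W⁺ at n = 2, open off totally real/CM fields; the modularity input is Freitas–Le Hung–Siksek Thms 3–4.
    sources: FreitasLeHungSiksek2015, paper:arxiv-2304.09003 p.9-10, Thorne2016, ArthurClozelAMS120, Tunnell1981
[support · ASYMPTOTIC / GENERIC REGIME of the switching engine · THEOREM-GRADE, closed-mod-print
given W⁺|₂ (17415) and R1 (24805)] GEN — the same conclusion for the ρ that have a 3–5–7-GENERIC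
totally real elliptic witness: some witness (L, K₀, E, χ) — K₀ totally real of ANY degree — whose
curve satisfies, for some p ∈ {3, 5, 7}, «ρ̄_{E,p}(Γ_{K₀(ζ_p)}) absolutely irreducible»
(`((E.framedTateGaloisRep p).restrictField (CyclotomicField p K₀)).IsResiduallyAbsIrreducible`).
Closed by Freitas–Le Hung–Siksek 2015 Thm 3 (p = 3, 5: Langlands–Tunnell + 3–5 switching) and Thm 4
(p = 7: 3–7 switching) — modularity of every such E over every totally real field [survey
arXiv:2304.09003 Thms 3.2, 3.3] — recorded in
Literature/NumberTheory/Automorphic/TotallyRealModularity.lean as «Thms 2–4 NOT vendored: no carrier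
for the residual image condition»; the carrier is this statement's clause (vendorable shape
DoorGenericModularity in the lens-5-g5 node, kernel generic_of_facts : DoorGenericModularity →
EllipticWitnessTransport → GenericEllipticAutomorphy), plus the per-witness solvable transport
(Arthur–Clozel base change, Langlands–Tunnell in the potentially abelian case, Clifford, SMO;
descent id -/
@[route_item "route-Langlands-PrimitiveRankLadder"]
def GenericEllipticAutomorphy : Prop :=
  ∀ (K : Type) [Field K] [NumberField K] (hcpt : Literature.NumberTheory.Automorphic.isCompact_glFiniteIntegralLevel 2 K) (ℓ : ℕ) [Fact ℓ.Prime] (ι : PadicAlgCl ℓ ≃+* ℂ) (ρ : Literature.NumberTheory.GaloisRepresentations.FramedGaloisRep K (PadicAlgCl ℓ) 2), ρ.toGaloisRep.IsIrreducible → ((∀ᶠ v : IsDedekindDomain.HeightOneSpectrum (NumberField.RingOfIntegers K) in Filter.cofinite, ρ.IsUnramifiedAt v) ∧ ∀ (v : IsDedekindDomain.HeightOneSpectrum (NumberField.RingOfIntegers K)) (hv : ((ℓ : ℕ) : NumberField.RingOfIntegers K) ∈ v.asIdeal), (Literature.NumberTheory.PAdicHodge.fontainePstAdicCompletion v ℓ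 hv).IsDeRhamFramed (ρ.toLocal v)) → ¬ (∃ η : Literature.NumberTheory.GaloisRepresentations.FramedGaloisRep K (PadicAlgCl ℓ) 1, (∃ᶠ v : IsDedekindDomain.HeightOneSpectrum (NumberField.RingOfIntegers K) in Filter.cofinite, ∃ a : PadicAlgCl ℓ, a ≠ 1 ∧ η.HasFrobCharpolyAt v (Polynomial.X - Polynomial.C a)) ∧ ∀ᶠ v : IsDedekindDomain.HeightOneSpectrum (NumberField.RingOfIntegers K) in Filter.cofinite, ∃ (P : Polynomial (PadicAlgCl ℓ)) (a : PadicAlgCl ℓ), ρ.HasFrobCharpolyAt v P ∧ η.HasFrobCharpolyAt v (Polynomial.X - Polynomial.C a) ∧ P.scaleRoots a = P) → (∃ (L : Type) (_ : Field L) (_ : NumberField L) (_ : Algebra K L), IsGalois K L ∧ IsSolvable (L ≃ₐ[K] L) ∧ ∃ (K₀ : Type) (_ : Field K₀) (_ : NumberField K₀) (_ : Algebra K₀ L), IsGalois K₀ L ∧ IsSolvable (L ≃ₐ[K₀] L) ∧ NumberField.IsTotallyReal K₀ ∧ ∃ (E : WeierstrassCurve K₀) (_ : E.IsElliptic) (χ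 : Literature.NumberTheory.GaloisRepresentations.FramedGaloisRep L (PadicAlgCl ℓ) 1), (∀ g : Field.absoluteGaloisGroup L, Literature.NumberTheory.GaloisRepresentations.FramedRep.trace (ρ.restrictField L) g = Literature.NumberTheory.GaloisRepresentations.FramedRep.trace χ g * Literature.NumberTheory.GaloisRepresentations.FramedRep.trace ((E.framedTateGaloisRep ℓ).restrictField L) g) ∧ (∃ (p : ℕ) (_ : Fact p.Prime), (p = 3 ∨ p = 5 ∨ p = 7) ∧ ((E.framedTateGaloisRep p).restrictField (CyclotomicField p K₀)).IsResiduallyAbsIrreducible)) → ∃ π : Literature.NumberTheory.Automorphic.CuspidalAutomorphicRepData 2 K hcpt, π.1.IsLAlgebraic ∧ ∀ᶠ v : IsDedekindDomain.HeightOneSpectrum (NumberField.RingOfIntegers K) in Filter.cofinite, SatakeFrobCompatibleAt ι π.1 ρ v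

-- parent: RankTwoPrimitiveAutomorphy · glue (gen 1)
/--     item stmt-Langlands-30757 · support · rank 204 · closed · proved by Summit.Langlands.Langlands.Theorems.RankTwoPrimitiveAutomorphy_of_split_proof (prover)
    parent: RankTwoPrimitiveAutomorphy · GLUE: children ⟹ parent · by planner
GenericEllipticAutomorphy → ExceptionalEllipticAutomorphy → NonEllipticRankTwoAutomorphy →
RankTwoPrimitiveAutomorphy — pure logic: excluded middle on the two inlined ∃-dials «has a totally
real elliptic witness» ⊇ «has a 3–5–7-generic one» (lens-5-g5 node
SwitchingEngineSplit.rankTwo_of_pieces; self-contained by_contra proof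
nodes/lens-5-g5-SwitchingEngineSplit.split_glue.lean, dials never restated) -/
@[route_item "route-Langlands-PrimitiveRankLadder"]
def RankTwoPrimitiveAutomorphy_of_split : Prop :=
  GenericEllipticAutomorphy → ExceptionalEllipticAutomorphy → NonEllipticRankTwoAutomorphy → RankTwoPrimitiveAutomorphy

-- `RankTwoPrimitiveAutomorphy_of_split` holds: proved by `Summit.Langlands.Langlands.Theorems.RankTwoPrimitiveAutomorphy_of_split_proof` (its module imports this route file, so no `_holds` link can be stated here).

/-- item stmt-Langlands-24804 · crux · rank 3 · open · by planner
why it might fail: for non-polarizable or residually inadequate ρ of rank ≥ 3 over a general number field only automorphy LIFTING / potential automorphy exist (twisted-endoscopy self-duality, Taylor–Wiles numerical coincidence); a single non-automorphic primitive geometric ρ₃ refutes it.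
sources: ClozelHarrisTaylor2008, BLGGT2014, ACCGHLNSTT2023, doi:10.1007/s13226-014-0088-1
[crux] Weak automorphy of every irreducible pinned-geometric ℓ-adic ρ of rank n ≥ 3 over any number
field WITHOUT self-twist (not cyclically induced): the residual of the ladder. Strictly weaker than
B_w is UNDECIDED with test «a printed de-symmetrisation of WEAK automorphy Sym²ρ₂ ⇒ ρ₂ in the open
grade-2 core»; instrumentable sub-sector: regular, polarizable, residually adequate and residually
automorphic (BLGGT Thm 4.2.1), CM non-polarizable (ACC+ Thm 6.1.1). TAGS (crit-1 CLEARED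
2026-08-30T01:33:42Z, row 4): WEAKER than S; vs RankTwoPrimitiveAutomorphy UNDECIDED[test: «Ad ρ₂
weakly automorphic ⇒ ρ₂ ⊗ χ weakly automorphic for some Hecke χ, for non-cohomological primitive ρ₂»
— not in print (crit-1 re-ran it: sign-spread needs ρ_{π₂}; the ⊗-auxiliary route dies on GL₆ zeros
= CPSConverseGL1 18579); if it lands, re-cut by functorial primitivity] · OPEN · IDEA-NEEDED · leaf
INSTRUMENTABLE sub-sector [BLGGT2014 Thm 4.2.1, ACCGHLNSTT2023 Thm 6.1.1] ·
BARRIER(`TwistedEndoscopySelfDual_holds`, `TaylorWilesNumericalCoincidence_holds`,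
`NonRegularWeightBarrier_holds`, `ShimuraVarietyRealizationBarrier_holds`). [difficulty:
open-problem] -/
@[route_item "route-Langlands-PrimitiveRankLadder", crux]
def HigherRankPrimitiveAutomorphy : Prop :=
  ∀ (K : Type) [Field K] [NumberField K] (n : ℕ) (hcpt : Literature.NumberTheory.Automorphic.isCompact_glFiniteIntegralLevel n K), 3 ≤ n → ∀ (ℓ : ℕ) [Fact ℓ.Prime] (ι : PadicAlgCl ℓ ≃+* ℂ) (ρ : Literature.NumberTheory.GaloisRepresentations.FramedGaloisRep K (PadicAlgCl ℓ) n), ρ.toGaloisRep.IsIrreducible → ((∀ᶠ v : IsDedekindDomain.HeightOneSpectrum (NumberField.RingOfIntegers K) in Filter.cofinite, ρ.IsUnramifiedAt v) ∧ ∀ (v : IsDedekindDomain.HeightOneSpectrum (NumberField.RingOfIntegers K)) (hv : ((ℓ : ℕ) : NumberField.RingOfIntegers K) ∈ v.asIdeal), (Literature.NumberTheory.PAdicHodge.fontainePstAdicCompletion v ℓ hv).IsDeRhamFramed (ρ.toLocal v)) → ¬ (∃ η : Literature.NumberTheory.GaloisRepresentations.FramedGaloisRep K (PadicAlgCl ℓ)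 1, (∃ᶠ v : IsDedekindDomain.HeightOneSpectrum (NumberField.RingOfIntegers K) in Filter.cofinite, ∃ a : PadicAlgCl ℓ, a ≠ 1 ∧ η.HasFrobCharpolyAt v (Polynomial.X - Polynomial.C a)) ∧ ∀ᶠ v : IsDedekindDomain.HeightOneSpectrum (NumberField.RingOfIntegers K) in Filter.cofinite, ∃ (P : Polynomial (PadicAlgCl ℓ)) (a : PadicAlgCl ℓ), ρ.HasFrobCharpolyAt v P ∧ η.HasFrobCharpolyAt v (Polynomial.X - Polynomial.C a) ∧ P.scaleRoots a = P) → ∃ π : Literature.NumberTheory.Automorphic.CuspidalAutomorphicRepData n K hcpt, π.1.IsLAlgebraic ∧ ∀ᶠ v : IsDedekindDomain.HeightOneSpectrum (NumberField.RingOfIntegers K) in Filter.cofinite, SatakeFrobCompatibleAt ι π.1 ρ v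

/-- item stmt-Langlands-17415 · crux · rank 4 · SPLIT (gen 4) into SpreadInducedAvatar, QuadraticTwistDescent, HigherInverseInduction, TowerTransport, WeaklyRegularHullAvatars, InaccessiblePrimitiveAvatars, CuspidalAvatarIrreducible + glue SatakeAvatarExistence_of_split5 · direct attempts still welcome (low priority) · by planner
why it might fail: Galois representations for non-cohomological π (Maass forms of eigenvalue 1/4, π over mixed-signature fields) and irreducibility of r_π for n ≥ 3 are open; no cohomological realisation of π_f is known there.
sources: HarrisLanTaylorThorneRMS2016, Scholze2015, BuzzardGeeLMS2014
earlier split gen 1: SpreadInducedAvatar, InducedAvatarDescent, RestrictionTwistTransport, InductionTransport, CollidingPrimitiveAvatars, CuspidalAvatarIrreducible — retired stmt-Langlands-23601, stmt-Langlands-29150, stmt-Langlands-29151, stmt-Langlands-32393, stmt-Langlands-32394, stmt-Langlands-32395, stmt-Langlands-33122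
earlier split gen 2: SpreadInducedAvatar, QuadraticTwistDescent, HigherInverseInduction, RestrictionTwistTransport, InductionTransport, CollidingPrimitiveAvatars, CuspidalAvatarIrreducible — retired stmt-Langlands-23601, stmt-Langlands-29150, stmt-Langlands-29151, stmt-Langlands-33222, stmt-Langlands-33223, stmt-Langlands-33224, stmt-Langlands-33225, stmt-Langlands-33412
earlier split gen 3: SpreadInducedAvatar, QuadraticTwistDescent, HigherInverseInduction, HullTransport, WeaklyRegularHullAvatars, DegeneratePrimitiveAvatars, CuspidalAvatarIrreducible — retired stmt-Langlands-23601, stmt-Langlands-33421, stmt-Langlands-33422, stmt-Langlands-33423, stmt-Langlands-33424, stmt-Langlands-33425, stmt-Langlands-33426, stmt-Langlands-33556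
retired/moot children: RestrictionTwistTransport [retired: ∀ (K₀ : Type) [Field K₀] [NumberField K₀] (M : Type) [Field M] [NumberField M] []; InductionTransport [retired: ∀ (K : Type) [Field K] [NumberField K] (L : Type) [Field L] [NumberField L] [Alg]; SpreadInducedAvatar [retired: ∀ (K : Type) [Field K] [NumberField K] (n : ℕ) (hcpt : Literature.NumberTheory.A]; InducedAvatarDescent [retired: ∀ (K : Type) [Field K] [NumberField K] (n : ℕ) (hcpt : Literature.NumberTheory.A]; CollidingPrimitiveAvatars [retired: ∀ (K : Type) [Field K] [NumberField K] (n : ℕ) (hcpt : Literature.NumberTheory.A]; SatakeAvatarExistence_of_split [replaced: SpreadInducedAvatar → InducedAvatarDescent → RestrictionTwistTransport → Inducti]; SatakeAvatarExistence_of_split [retired: SpreadInducedAvatar → (∀ (K : Type) [Field K] [NumberField K] (n : ℕ) (hcpt : Li]; SpreadInducedAvatar [retired: ∀ (K : Type) [Field K] [NumberField K] (n : ℕ) (hcpt : Literature.NumberTheory.A]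
[crux] W⁺ — for every number field K, n ≥ 1, every L-algebraic cuspidal π of GL_n(𝔸_K) and every (ℓ,
ι) there is an IRREDUCIBLE ρ : Γ_K → GL_n(ℚ̄_ℓ) Satake–Frobenius compatible with (π, ι) at almost
all places (Buzzard–Gee Conj. 3.2.2 weak form + Ramakrishnan's cuspidal ⇒ irreducible; Clozel's
Conj. 1.1.1 in arXiv:2607.11763). No de Rham clause, no Rec: ε-free and Rec-free. [difficulty:
open-problem] -/
@[route_item "route-Langlands-PrimitiveRankLadder", crux]
def SatakeAvatarExistence : Prop :=
  ∀ (K : Type) [Field K] [NumberField K] (n : ℕ) (hcpt : Literature.NumberTheory.Automorphic.isCompact_glFiniteIntegralLevel n K), 0 < n → ∀ (π : Literature.NumberTheory.Automorphic.CuspidalAutomorphicRepData n K hcpt), π.1.IsLAlgebraic → ∀ (ℓ : ℕ) [Fact ℓ.Prime] (ι : PadicAlgCl ℓ ≃+* ℂ), ∃ ρ : Literature.NumberTheory.GaloisRepresentations.FramedGaloisRep K (PadicAlgCl ℓ) n, ρ.toGaloisRep.IsIrreducible ∧ ∀ᶠ v : IsDedekindDomain.HeightOneSpectrum (NumberField.RingOfIntegers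 K) in cofinite, SatakeFrobCompatibleAt ι π.1 ρ v

-- parent: SatakeAvatarExistence · child (gen 4)
/--     item stmt-Langlands-33570 · crux · rank 402 · open
    parent: SatakeAvatarExistence · by planner
    why it might fail: Taylor 1994 §3 (no abelian constituent of ρ^μ|_L unless BC_L(π⊗μ) is non-cuspidal) is stated for K imaginary quadratic; over a DARK K the ℓ-adic character constituent must still be shown automorphic (local algebraicity) before JS applies.
    sources: arXiv:0707.1338, arXiv:1109.5392, doi:10.1007/bf01231575, doi:10.1007/bf01232440, ArthurClozelAMS120, Henniart2012
[crux · ATTACKABLE-BY-ENGINE · box (n,[K:K₀]) = (2,2) of the inverse-induction grading · WEAKER than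
EXT 32394 / W⁺ 17415 / E 23598 / Langlands in the kernel (lens-1-g10 node InverseInductionLadder)] Q
— K/K₀ quadratic (cyclic Galois, finrank 2), T an infinity type on GL₂/K with
InfinityType.automorphicInduction K₀ (2[K:K₀]) T REGULAR, (ℓ, ι) fixed. HYPOTHESIS = the TWIST
FAMILY: every cuspidal L-algebraic π′ on GL₂/K of type T has, at every compact level over K₀, a weak
automorphic induction P′ along K/K₀ (IsAutomorphicInductionAlong π′ P′) with a SEMISIMPLE a.e.
Satake–Frobenius avatar R′ (= SPRAI's conclusion quantified over the type-T family; fed by SPRAI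
32393 when K₀ is TR/CM; stable under finite-order twists). CONCLUSION: every cuspidal L-algebraic π
of type T has a semisimple avatar ρ : Γ_K → GL₂(ℚ̄_ℓ) a.e. ENGINE (print, transplanted):
Berger–Harcos 2007 §§4–6 (Lemma 4.1 R ⊗ χ_{K/K₀} ≅ R ⇒ R ≅ Ind ρ^{(μ)}; Lemma 5.1 ρ^μ|_L irreducible
for quadratic L/K via Taylor 1994 §3 + cyclic base change, else π dihedral; Lemma 5.2 Schur +
Hilbert 90; Lemma 5.3 one ρ with ρ^μ ⊕ (ρ^μ)^σ ≅ ρ⊗μ ⊕ (ρ⊗μ)^σ for all μ; §6 at w split over K₀ a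
twist μ with μ(w) ≠ μ(w^σ) separates {γ_w, δ_w} = -/
@[route_item "route-Langlands-PrimitiveRankLadder"]
def QuadraticTwistDescent : Prop :=
  ∀ (K : Type) [Field K] [NumberField K] (hcpt : Literature.NumberTheory.Automorphic.isCompact_glFiniteIntegralLevel 2 K) (K₀ : Type) [Field K₀] [NumberField K₀] [Algebra K₀ K], IsGalois K₀ K → IsCyclic (K ≃ₐ[K₀] K) → Module.finrank K₀ K = 2 → ∀ (T : Literature.NumberTheory.Automorphic.InfinityType K 2), (Literature.NumberTheory.Automorphic.InfinityType.automorphicInduction K₀ (2 * Module.finrank K₀ K) T).IsRegular → ∀ (ℓ : ℕ) [Fact ℓ.Prime] (ι : PadicAlgCl ℓ ≃+* ℂ), (∀ (π' : Literature.NumberTheory.Automorphic.CuspidalAutomorphicRepData 2 K hcpt), π'.1.IsLAlgebraic → π'.1.HasInfinityType T → ∀ (hK₀ : Literature.NumberTheory.Automorphic.isCompact_glFiniteIntegralLevel (2 * Module.finrank K₀ K) K₀), ∃ (P : Literature.NumberTheory.Automorphic.AutomorphicRepData (Literature.NumberTheory.Automorphic.AutomorphyDatum.gl (2 * Module.finrank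 K₀ K) K₀ hK₀)) (R : Literature.NumberTheory.GaloisRepresentations.FramedGaloisRep K₀ (PadicAlgCl ℓ) (2 * Module.finrank K₀ K)), Literature.NumberTheory.Automorphic.IsAutomorphicInductionAlong π'.1 P ∧ R.toGaloisRep.IsSemisimple ∧ ∀ᶠ v : IsDedekindDomain.HeightOneSpectrum (NumberField.RingOfIntegers K₀) in Filter.cofinite, SatakeFrobCompatibleAt ι P R v) → ∀ (π : Literature.NumberTheory.Automorphic.CuspidalAutomorphicRepData 2 K hcpt), π.1.IsLAlgebraic → π.1.HasInfinityType T → ∃ ρ : Literature.NumberTheory.GaloisRepresentations.FramedGaloisRep K (PadicAlgCl ℓ) 2, ρ.toGaloisRep.IsSemisimple ∧ ∀ᶠ w : IsDedekindDomain.HeightOneSpectrum (NumberField.RingOfIntegers K) in Filter.cofinite, SatakeFrobCompatibleAt ι π.1 ρ w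

-- parent: SatakeAvatarExistence · child (gen 4)
/--     item stmt-Langlands-33571 · crux · rank 403 · open
    parent: SatakeAvatarExistence · by planner
    why it might fail: For n ≥ 3 the constituents of R|Γ_K are told apart only by automorphy over the DARK field K: a ‘Franken-constituent’ A ⊕ B^σ mixing π and π^σ is not excluded by Satake data of the inductions of the twist family; no inverse-AI theorem for avatars in print.
    sources: arXiv:0707.1338, arXiv:1109.5392, ArthurClozelAMS120, Henniart2012, PatrikisTaylor2014, BuzzardGeeLMS2014
[crux · IDEA-NEEDED · complement box ¬(n = 2 ∧ [K:K₀] = 2) · WEAKER than EXT / W⁺ / E / Langlands in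
the kernel (lens-1-g10 node InverseInductionLadder)] H — the same family-form inverse cyclic
automorphic induction for SEMISIMPLE avatars under induced regularity (K/K₀ cyclic Galois of any
degree d, rank n, type T with induced type regular; hypothesis: every type-T cuspidal L-algebraic π′
has a weak automorphic induction P′ along K/K₀ with a semisimple a.e. avatar R′; conclusion: every
type-T cuspidal L-algebraic π has a semisimple a.e. avatar over K), OFF the (2,2) box. GRADED
INTERIOR (lens-1 ladder; cut here next): n = 1 CLOSED IN PRINT (Weil 1956 / CFT, any d); d = 1
trivial; (2, d ≥ 3) UNDECIDED-leaning-attackable (BH engine with μ of order 2d separating the d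
conjugates; first instance K = ℚ(√−3, ∛2) ⊃ ℚ(√−3)); n ≥ 3 the IDEA-NEEDED core: BH Lemma 5.3's
either/or rigidity needs the n-dimensional candidate constituents ρ^μ of R^μ|Γ_K IRREDUCIBLE on
cyclic overfields — for n = 2 this is «constituents are characters ⇒ Hecke characters ⇒ JS», for n ≥
3 a reducible ρ^μ = A ⊕ B matching no automorphic datum is excluded by nothing short of automorphy
over the dark K (an IRR-type inp -/
@[route_item "route-Langlands-PrimitiveRankLadder"]
def HigherInverseInduction : Prop :=
  ∀ (K : Type) [Field K] [NumberField K] (n : ℕ) (hcpt : Literature.NumberTheory.Automorphic.isCompact_glFiniteIntegralLevel n K), 0 < n → ∀ (K₀ : Type) [Field K₀] [NumberField K₀] [Algebra K₀ K], IsGalois K₀ K → IsCyclic (K ≃ₐ[K₀] K) → ¬ (n = 2 ∧ Module.finrank K₀ K = 2) → ∀ (T : Literature.NumberTheory.Automorphic.InfinityType K n), (Literature.NumberTheory.Automorphic.InfinityType.automorphicInduction K₀ (n * Module.finrank K₀ K) T).IsRegular → ∀ (ℓ : ℕ) [Fact ℓ.Prime] (ι : PadicAlgCl ℓ ≃+*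 ℂ), (∀ (π' : Literature.NumberTheory.Automorphic.CuspidalAutomorphicRepData n K hcpt), π'.1.IsLAlgebraic → π'.1.HasInfinityType T → ∀ (hK₀ : Literature.NumberTheory.Automorphic.isCompact_glFiniteIntegralLevel (n * Module.finrank K₀ K) K₀), ∃ (P : Literature.NumberTheory.Automorphic.AutomorphicRepData (Literature.NumberTheory.Automorphic.AutomorphyDatum.gl (n * Module.finrank K₀ K) K₀ hK₀)) (R : Literature.NumberTheory.GaloisRepresentations.FramedGaloisRep K₀ (PadicAlgCl ℓ) (n * Module.finrank K₀ K)), Literature.NumberTheory.Automorphic.IsAutomorphicInductionAlong π'.1 P ∧ R.toGaloisRep.IsSemisimple ∧ ∀ᶠ v : IsDedekindDomain.HeightOneSpectrum (NumberField.RingOfIntegers K₀) in Filter.cofinite, SatakeFrobCompatibleAt ι P R v) → ∀ (π : Literature.NumberTheory.Automorphic.CuspidalAutomorphicRepData n K hcpt), π.1.IsLAlgebraic → π.1.HasInfinityType T → ∃ ρ : Literature.NumberTheory.GaloisRepresentations.FramedGaloisRep K (PadicAlgCl ℓ) n, ρ.toGaloisRep.IsSemisimple ∧ ∀ᶠ w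 : IsDedekindDomain.HeightOneSpectrum (NumberField.RingOfIntegers K) in Filter.cofinite, SatakeFrobCompatibleAt ι π.1 ρ w

-- parent: SatakeAvatarExistence · child (gen 4)
/--     item stmt-Langlands-33573 · crux · rank 405 · open
    parent: SatakeAvatarExistence · by planner
    why it might fail: A cuspidal π on GL₂ over a CM field of partial weight one (strict rung 2 at K₀ = K, non-polarised: no Shimura variety, no oddness) with no ℓ-adic avatar refutes it; print (F–P 9.10, BCGP) covers only polarised-odd data, and inverse induction is open for n ≥ 3.
    sources: FakhruddinPilloni2021, BoxerEtAl2021, arXiv:1109.5392, BergerHarcos2007, Taylor1994, Taylor1991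
[crux · THE BELT HULL₂ ∖ HULL₁ of the residual · WEAKER than REST♯ 33225 / W⁺ 17415 / E 23598 /
Langlands in the kernel (lens-1-g11 node WeaklyRegularInductionLadder:
`weaklyRegularHullAvatars_of_colliding`, `…_of_satakeAvatarExistence`, `…_of_semisimpleAvatar`,
`…_of_langlands`) · UNDECIDED with graded leaves ATTACKABLE-BY-ENGINE / PRINT / BARRIER /
IDEA-NEEDED] WHS — every cuspidal L-algebraic π on GL_n/K (0 < n) whose datum is OFF the
regular-induction hull HULL₁ (first inlined least class = the hypothesis of REST♯ verbatim: rung 1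
«some cyclic Galois descent K/K₀, K₀ totally real or CM, makes the automorphically induced infinity
type REGULAR», closed under (up) a.e.-twisted weak base change up and (ai) automorphic induction
down) but ON the weakly-regular-induction hull HULL₂ (second inlined least class: same closure
clauses, seed = rung ≤ 2 «… makes the induced type WEAKLY REGULAR», InfinityType.IsWeaklyRegular =
Fakhruddin–Pilloni 2021 §9.1: every archimedean multiplicity ≤ 2) has, for every (ℓ, ι), a
SEMISIMPLE ℓ-adic avatar matching its Satake parameters a.e. (irreducibility is IRR 23601's).
LADDER: μ*(π) = min over cyclic TR/CM descents of the largest archimedean multipli -/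
@[route_item "route-Langlands-PrimitiveRankLadder"]
def WeaklyRegularHullAvatars : Prop :=
  ∀ (K : Type) [Field K] [NumberField K] (n : ℕ) (hcpt : Literature.NumberTheory.Automorphic.isCompact_glFiniteIntegralLevel n K), 0 < n → ∀ (π : Literature.NumberTheory.Automorphic.CuspidalAutomorphicRepData n K hcpt), π.1.IsLAlgebraic → ¬ (∀ S : (∀ (K : Type) [Field K] [NumberField K] (n : ℕ) (hcpt : Literature.NumberTheory.Automorphic.isCompact_glFiniteIntegralLevel n K), Literature.NumberTheory.Automorphic.AutomorphicRepData (Literature.NumberTheory.Automorphic.AutomorphyDatum.gl n K hcpt) → Prop), ((∀ (K : Type) [Field K] [NumberField K] (n : ℕ) (hcpt : Literature.NumberTheory.Automorphic.isCompact_glFiniteIntegralLevel n K) (π : Literature.NumberTheory.Automorphic.CuspidalAutomorphicRepData n K hcpt), 0 < n → π.1.IsLAlgebraic → (∃ (K₀ : Type) (_ : Field K₀) (_ : NumberField K₀) (_ : Algebra K₀ K), IsGalois K₀ K ∧ IsCyclic (K ≃ₐ[K₀] K) ∧ (NumberField.IsTotallyReal K₀ ∨ NumberField.IsCMField K₀)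 ∧ ∃ T : Literature.NumberTheory.Automorphic.InfinityType K n, π.1.HasInfinityType T ∧ (Literature.NumberTheory.Automorphic.InfinityType.automorphicInduction K₀ (n * Module.finrank K₀ K) T).IsRegular) → S K n hcpt π.1) ∧ (∀ (K₀ : Type) [Field K₀] [NumberField K₀] (M : Type) [Field M] [NumberField M] [Algebra K₀ M] (n : ℕ) (h₀ : Literature.NumberTheory.Automorphic.isCompact_glFiniteIntegralLevel n K₀) (hM : Literature.NumberTheory.Automorphic.isCompact_glFiniteIntegralLevel n M) (h₁ : Literature.NumberTheory.Automorphic.isCompact_glFiniteIntegralLevel 1 M) (π₀ : Literature.NumberTheory.Automorphic.CuspidalAutomorphicRepData n K₀ h₀) (χ : Literature.NumberTheory.Automorphic.AutomorphicRepData (Literature.NumberTheory.Automorphic.AutomorphyDatum.gl 1 M h₁)) (P : Literature.NumberTheory.Automorphic.AutomorphicRepData (Literature.NumberTheory.Automorphic.AutomorphyDatum.gl n M hM)), π₀.1.IsLAlgebraic → χ.IsLAlgebraic → (∀ᶠ w : IsDedekindDomain.HeightOneSpectrum (NumberField.RingOfIntegers M) in cofinite, ∀ (u : IsDedekindDomain.HeightOneSpectrum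 (NumberField.RingOfIntegers K₀)) (α : Multiset ℂ) (c : ℂ), w.asIdeal.under (NumberField.RingOfIntegers K₀) = u.asIdeal → π₀.1.HasSatakeParamAt u α → χ.HasSatakeParamAt w {c} → P.HasSatakeParamAt w ((α.map (· ^ w.asIdeal.inertiaDeg (NumberField.RingOfIntegers K₀))).map (c * ·))) → S K₀ n h₀ π₀.1 → S M n hM P) ∧ (∀ (K : Type) [Field K] [NumberField K] (L : Type) [Field L] [NumberField L] [Algebra K L] (m n : ℕ) (hL : Literature.NumberTheory.Automorphic.isCompact_glFiniteIntegralLevel m L) (hcpt : Literature.NumberTheory.Automorphic.isCompact_glFiniteIntegralLevel n K) (σ : Literature.NumberTheory.Automorphic.CuspidalAutomorphicRepData m L hL) (π : Literature.NumberTheory.Automorphic.AutomorphicRepData (Literature.NumberTheory.Automorphic.AutomorphyDatum.gl n K hcpt)), 0 < m → σ.1.IsLAlgebraic → (∀ᶠ v : IsDedekindDomain.HeightOneSpectrum (NumberField.RingOfIntegers K) in cofinite, ∀ β : IsDedekindDomain.HeightOneSpectrum (NumberField.RingOfIntegers L) → Multiset ℂ, (∀ w : IsDedekindDomain.HeightOneSpectrum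 (NumberField.RingOfIntegers L), w.asIdeal.under (NumberField.RingOfIntegers K) = v.asIdeal → σ.1.HasSatakeParamAt w (β w)) → ∃ α : Multiset ℂ, π.HasSatakeParamAt v α ∧ Literature.NumberTheory.Automorphic.satakePolynomial α = ∏ᶠ w ∈ {w : IsDedekindDomain.HeightOneSpectrum (NumberField.RingOfIntegers L) | w.asIdeal.under (NumberField.RingOfIntegers K) = v.asIdeal}, (Literature.NumberTheory.Automorphic.satakePolynomial (β w)).comp (Polynomial.X ^ w.asIdeal.inertiaDeg (NumberField.RingOfIntegers K))) → S L m hL σ.1 → S K n hcpt π)) → S K n hcpt π.1) → (∀ S : (∀ (K : Type) [Field K] [NumberField K] (n : ℕ) (hcpt : Literature.NumberTheory.Automorphic.isCompact_glFiniteIntegralLevel n K), Literature.NumberTheory.Automorphic.AutomorphicRepData (Literature.NumberTheory.Automorphic.AutomorphyDatum.gl n K hcpt) → Prop), ((∀ (K : Type) [Field K] [NumberField K] (n : ℕ) (hcpt : Literature.NumberTheory.Automorphic.isCompact_glFiniteIntegralLevel n K) (π : Literature.NumberTheory.Automorphic.CuspidalAutomorphicRepData n K hcpt), 0 < n → π.1.IsLAlgebraic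 → (∃ (K₀ : Type) (_ : Field K₀) (_ : NumberField K₀) (_ : Algebra K₀ K), IsGalois K₀ K ∧ IsCyclic (K ≃ₐ[K₀] K) ∧ (NumberField.IsTotallyReal K₀ ∨ NumberField.IsCMField K₀) ∧ ∃ T : Literature.NumberTheory.Automorphic.InfinityType K n, π.1.HasInfinityType T ∧ (Literature.NumberTheory.Automorphic.InfinityType.automorphicInduction K₀ (n * Module.finrank K₀ K) T).IsWeaklyRegular) → S K n hcpt π.1) ∧ (∀ (K₀ : Type) [Field K₀] [NumberField K₀] (M : Type) [Field M] [NumberField M] [Algebra K₀ M] (n : ℕ) (h₀ : Literature.NumberTheory.Automorphic.isCompact_glFiniteIntegralLevel n K₀) (hM : Literature.NumberTheory.Automorphic.isCompact_glFiniteIntegralLevel n M) (h₁ : Literature.NumberTheory.Automorphic.isCompact_glFiniteIntegralLevel 1 M) (π₀ : Literature.NumberTheory.Automorphic.CuspidalAutomorphicRepData n K₀ h₀) (χ : Literature.NumberTheory.Automorphic.AutomorphicRepData (Literature.NumberTheory.Automorphic.AutomorphyDatum.gl 1 M h₁)) (P : Literature.NumberTheory.Automorphic.AutomorphicRepData (Literature.NumberTheory.Automorphic.AutomorphyDatum.gl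 n M hM)), π₀.1.IsLAlgebraic → χ.IsLAlgebraic → (∀ᶠ w : IsDedekindDomain.HeightOneSpectrum (NumberField.RingOfIntegers M) in cofinite, ∀ (u : IsDedekindDomain.HeightOneSpectrum (NumberField.RingOfIntegers K₀)) (α : Multiset ℂ) (c : ℂ), w.asIdeal.under (NumberField.RingOfIntegers K₀) = u.asIdeal → π₀.1.HasSatakeParamAt u α → χ.HasSatakeParamAt w {c} → P.HasSatakeParamAt w ((α.map (· ^ w.asIdeal.inertiaDeg (NumberField.RingOfIntegers K₀))).map (c * ·))) → S K₀ n h₀ π₀.1 → S M n hM P) ∧ (∀ (K : Type) [Field K] [NumberField K] (L : Type) [Field L] [NumberField L] [Algebra K L] (m n : ℕ) (hL : Literature.NumberTheory.Automorphic.isCompact_glFiniteIntegralLevel m L) (hcpt : Literature.NumberTheory.Automorphic.isCompact_glFiniteIntegralLevel n K) (σ : Literature.NumberTheory.Automorphic.CuspidalAutomorphicRepData m L hL) (π : Literature.NumberTheory.Automorphic.AutomorphicRepData (Literature.NumberTheory.Automorphic.AutomorphyDatum.gl n K hcpt)), 0 < m → σ.1.IsLAlgebraic → (∀ᶠ v :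 IsDedekindDomain.HeightOneSpectrum (NumberField.RingOfIntegers K) in cofinite, ∀ β : IsDedekindDomain.HeightOneSpectrum (NumberField.RingOfIntegers L) → Multiset ℂ, (∀ w : IsDedekindDomain.HeightOneSpectrum (NumberField.RingOfIntegers L), w.asIdeal.under (NumberField.RingOfIntegers K) = v.asIdeal → σ.1.HasSatakeParamAt w (β w)) → ∃ α : Multiset ℂ, π.HasSatakeParamAt v α ∧ Literature.NumberTheory.Automorphic.satakePolynomial α = ∏ᶠ w ∈ {w : IsDedekindDomain.HeightOneSpectrum (NumberField.RingOfIntegers L) | w.asIdeal.under (NumberField.RingOfIntegers K) = v.asIdeal}, (Literature.NumberTheory.Automorphic.satakePolynomial (β w)).comp (Polynomial.X ^ w.asIdeal.inertiaDeg (NumberField.RingOfIntegers K))) → S L m hL σ.1 → S K n hcpt π)) → S K n hcpt π.1) → ∀ (ℓ : ℕ) [Fact ℓ.Prime] (ι : PadicAlgCl ℓ ≃+* ℂ), ∃ ρ : Literature.NumberTheory.GaloisRepresentations.FramedGaloisRep K (PadicAlgCl ℓ) n, ρ.toGaloisRep.IsSemisimple ∧ ∀ᶠ v : IsDedekindDomain.HeightOneSpectrum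 (NumberField.RingOfIntegers K) in Filter.cofinite, SatakeFrobCompatibleAt ι π.1 ρ v

-- parent: SatakeAvatarExistence · child (gen 4)
/--     item stmt-Langlands-33574 · crux · rank 406 · open
    parent: SatakeAvatarExistence · by planner
    why it might fail: It IS the hard core: one cuspidal weight-0 π on GL₃/ℚ (triple archimedean collision under every descent) or one primitive π over ℚ(∛2) (no cyclic tower to a TR/CM field) without an ℓ-adic avatar refutes it; no cohomological realisation or descent exists there.
    sources: Scholze2015, Calegari2023, BuzzardGeeLMS2014, FakhruddinPilloni2021, CalegariGeraghty2018, HarrisLanTaylorThorneRMS2016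
[crux · DECLARED RESIDUAL of the resplit · SATURATED · WEAKER than REST₃ 33426 (kernel
`inaccessiblePrimitiveAvatars_of_degenerate` via `hull2_le_hull3`), than W⁺ 17415, than Langlands
(lens-1-g12 node TowerInductionLadder) · = REST₃ with HULL₂ ↦ HULL₃ textually · REST₃ ⟺ REST₄ given
SPRAI, Q, H, TRN₃, WHS, IRR (kernel `degeneratePrimitiveAvatars_iff`: the tower belt costs NO new
crux)] REST₄ — W⁺ VERBATIM (irreducible ℓ-adic avatar matching Satake a.e., every (ℓ, ι)) for the
cuspidal L-algebraic π on GL_n/K whose datum lies OFF the tower-induction hull HULL₃ = the least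
class of automorphic data that (r0₂) contains every cuspidal L-algebraic π at rung ≤ 2 (some cyclic
Galois descent K/K₀, K₀ totally real or CM, K₀ = K allowed, makes the induced infinity type WEAKLY
REGULAR, F–P 2021 §9.1 — HULL₂'s seed verbatim), is closed under (up) a.e.-twisted weak base change
UP and (ai) automorphic induction DOWN (RootDecomp1 29147's clauses verbatim, discharged by
RTT/AIT), AND under (ext) the DARK STEP: K/K₀ cyclic Galois with K₀ ARBITRARY, T with AI_{K/K₀}(T)
REGULAR — if every cuspidal L-algebraic σ on GL_m/K₀ with an infinity type pointwise ≤ AI_{K/K₀}(T)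
is in the class then every cuspi -/
@[route_item "route-Langlands-PrimitiveRankLadder"]
def InaccessiblePrimitiveAvatars : Prop :=
  ∀ (K : Type) [Field K] [NumberField K] (n : ℕ) (hcpt : Literature.NumberTheory.Automorphic.isCompact_glFiniteIntegralLevel n K), 0 < n → ∀ (π : Literature.NumberTheory.Automorphic.CuspidalAutomorphicRepData n K hcpt), π.1.IsLAlgebraic → ¬ (∀ S : (∀ (K : Type) [Field K] [NumberField K] (n : ℕ) (hcpt : Literature.NumberTheory.Automorphic.isCompact_glFiniteIntegralLevel n K), Literature.NumberTheory.Automorphic.AutomorphicRepData (Literature.NumberTheory.Automorphic.AutomorphyDatum.gl n K hcpt) → Prop), ((∀ (K : Type) [Field K] [NumberField K] (n : ℕ) (hcpt : Literature.NumberTheory.Automorphic.isCompact_glFiniteIntegralLevel n K) (π : Literature.NumberTheory.Automorphic.CuspidalAutomorphicRepData n K hcpt), 0 < n → π.1.IsLAlgebraic → (∃ (K₀ : Type) (_ : Field K₀) (_ : NumberField K₀) (_ : Algebra K₀ K), IsGalois K₀ K ∧ IsCyclic (K ≃ₐ[K₀] K) ∧ (NumberField.IsTotallyReal K₀ ∨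 NumberField.IsCMField K₀) ∧ ∃ T : Literature.NumberTheory.Automorphic.InfinityType K n, π.1.HasInfinityType T ∧ (Literature.NumberTheory.Automorphic.InfinityType.automorphicInduction K₀ (n * Module.finrank K₀ K) T).IsWeaklyRegular) → S K n hcpt π.1) ∧ (∀ (K₀ : Type) [Field K₀] [NumberField K₀] (M : Type) [Field M] [NumberField M] [Algebra K₀ M] (n : ℕ) (h₀ : Literature.NumberTheory.Automorphic.isCompact_glFiniteIntegralLevel n K₀) (hM : Literature.NumberTheory.Automorphic.isCompact_glFiniteIntegralLevel n M) (h₁ : Literature.NumberTheory.Automorphic.isCompact_glFiniteIntegralLevel 1 M) (π₀ : Literature.NumberTheory.Automorphic.CuspidalAutomorphicRepData n K₀ h₀) (χ : Literature.NumberTheory.Automorphic.AutomorphicRepData (Literature.NumberTheory.Automorphic.AutomorphyDatum.gl 1 M h₁)) (P : Literature.NumberTheory.Automorphic.AutomorphicRepData (Literature.NumberTheory.Automorphic.AutomorphyDatum.gl n M hM)), π₀.1.IsLAlgebraic → χ.IsLAlgebraic → (∀ᶠ w : IsDedekindDomain.HeightOneSpectrum (NumberField.RingOfIntegers M) in cofinite,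 ∀ (u : IsDedekindDomain.HeightOneSpectrum (NumberField.RingOfIntegers K₀)) (α : Multiset ℂ) (c : ℂ), w.asIdeal.under (NumberField.RingOfIntegers K₀) = u.asIdeal → π₀.1.HasSatakeParamAt u α → χ.HasSatakeParamAt w {c} → P.HasSatakeParamAt w ((α.map (· ^ w.asIdeal.inertiaDeg (NumberField.RingOfIntegers K₀))).map (c * ·))) → S K₀ n h₀ π₀.1 → S M n hM P) ∧ (∀ (K : Type) [Field K] [NumberField K] (L : Type) [Field L] [NumberField L] [Algebra K L] (m n : ℕ) (hL : Literature.NumberTheory.Automorphic.isCompact_glFiniteIntegralLevel m L) (hcpt : Literature.NumberTheory.Automorphic.isCompact_glFiniteIntegralLevel n K) (σ : Literature.NumberTheory.Automorphic.CuspidalAutomorphicRepData m L hL) (π : Literature.NumberTheory.Automorphic.AutomorphicRepData (Literature.NumberTheory.Automorphic.AutomorphyDatum.gl n K hcpt)), 0 < m → σ.1.IsLAlgebraic → (∀ᶠ v : IsDedekindDomain.HeightOneSpectrum (NumberField.RingOfIntegers K) in cofinite, ∀ β : IsDedekindDomain.HeightOneSpectrum (NumberField.RingOfIntegers L) → Multiset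 ℂ, (∀ w : IsDedekindDomain.HeightOneSpectrum (NumberField.RingOfIntegers L), w.asIdeal.under (NumberField.RingOfIntegers K) = v.asIdeal → σ.1.HasSatakeParamAt w (β w)) → ∃ α : Multiset ℂ, π.HasSatakeParamAt v α ∧ Literature.NumberTheory.Automorphic.satakePolynomial α = ∏ᶠ w ∈ {w : IsDedekindDomain.HeightOneSpectrum (NumberField.RingOfIntegers L) | w.asIdeal.under (NumberField.RingOfIntegers K) = v.asIdeal}, (Literature.NumberTheory.Automorphic.satakePolynomial (β w)).comp (Polynomial.X ^ w.asIdeal.inertiaDeg (NumberField.RingOfIntegers K))) → S L m hL σ.1 → S K n hcpt π) ∧ (∀ (K : Type) [Field K] [NumberField K] (n : ℕ) (hcpt : Literature.NumberTheory.Automorphic.isCompact_glFiniteIntegralLevel n K), 0 < n → ∀ (K₀ : Type) [Field K₀] [NumberField K₀] [Algebra K₀ K], IsGalois K₀ K → IsCyclic (K ≃ₐ[K₀] K) → ∀ (T : Literature.NumberTheory.Automorphic.InfinityType K n), (Literature.NumberTheory.Automorphic.InfinityType.automorphicInduction K₀ (n * Module.finrank K₀ K) T).IsRegular → (∀ (m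 : ℕ) (hm : Literature.NumberTheory.Automorphic.isCompact_glFiniteIntegralLevel m K₀) (σ : Literature.NumberTheory.Automorphic.CuspidalAutomorphicRepData m K₀ hm) (τ : Literature.NumberTheory.Automorphic.InfinityType K₀ m), 0 < m → σ.1.IsLAlgebraic → σ.1.HasInfinityType τ → (∀ e : K₀ →+* ℂ, τ e ≤ (Literature.NumberTheory.Automorphic.InfinityType.automorphicInduction K₀ (n * Module.finrank K₀ K) T) e) → S K₀ m hm σ.1) → ∀ (π : Literature.NumberTheory.Automorphic.CuspidalAutomorphicRepData n K hcpt), π.1.IsLAlgebraic → π.1.HasInfinityType T → S K n hcpt π.1)) → S K n hcpt π.1) → ∀ (ℓ : ℕ) [Fact ℓ.Prime] (ι : PadicAlgCl ℓ ≃+* ℂ), ∃ ρ : Literature.NumberTheory.GaloisRepresentations.FramedGaloisRep K (PadicAlgCl ℓ) n, ρ.toGaloisRep.IsIrreducible ∧ ∀ᶠ v : IsDedekindDomain.HeightOneSpectrum (NumberField.RingOfIntegers K) in Filter.cofinite, SatakeFrobCompatibleAt ι π.1 ρ v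

-- parent: SatakeAvatarExistence · child (gen 4)
/--     item stmt-Langlands-23601 · crux · rank 407 · open
    parent: SatakeAvatarExistence · by planner
    why it might fail: Irreducibility of r_ℓ(π) for cuspidal regular algebraic π over CM fields is known only for density-one sets of ℓ / under polarizability (Patrikis–Taylor, Xia); for irregular or non-polarizable π nothing beyond n ≤ 3 (Ramakrishnan).
    sources: PatrikisTaylor2014, Ramakrishnan2009, BuzzardGeeLMS2014, arXiv:2607.11763
[crux] [NEW root-level piece, the irreducibility half of W⁺; verbatim the registered stub
`…SectorComplement.BirthSatakeAvatarExistence.stub_cuspidalAvatarIrreducible`; WEAKER than Langlands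
(necessity: a semisimple Satake-compatible ρ is conjugate to the irreducible avatar by Chebotarev +
Brauer–Nesbitt, cf. `SoloBlind.isIrreducible_of_eventually`); leaf IDEA-NEEDED, «no catalogued
barrier»; known: n ≤ 3 (Ribet, Blasius–Rogawski), polarizable regular n ≤ 5 / density-one ℓ
(Calegari–Gee, Patrikis–Taylor, Böckle–Hui 2025); Rec-free root-level parent of the irreducibility
sector routes (IrreducibilityBySelfDuality, ExteriorSquareAscent, FrobeniusMoment); critic: CLEARED
decomp-langlands-crit-1-g0 0 2026-08-30T01:15:58Z (pub/decomp-langlands/STATUS.md; CRITIC-LEDGER.md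
row 01:15:58Z)] every SEMISIMPLE framed ρ : Γ_K → GL_n(ℚ̄_ℓ) that is Satake–Frobenius compatible
a.e. with an L-algebraic CUSPIDAL (π, ι) is irreducible (Ramakrishnan's cuspidality ⇒ irreducibility
conjecture, Satake-level form). [deps: SemisimpleAvatar] [difficulty: open-problem] -/
@[route_item "route-Langlands-PrimitiveRankLadder"]
def CuspidalAvatarIrreducible : Prop :=
  ∀ (K : Type) [Field K] [NumberField K] (n : ℕ) (hcpt : Literature.NumberTheory.Automorphic.isCompact_glFiniteIntegralLevel n K), 0 < n → ∀ (π : Literature.NumberTheory.Automorphic.CuspidalAutomorphicRepData n K hcpt), π.1.IsLAlgebraic → ∀ (ℓ : ℕ) [Fact ℓ.Prime] (ι : PadicAlgCl ℓ ≃+* ℂ) (ρ : Literature.NumberTheory.GaloisRepresentations.FramedGaloisRep K (PadicAlgCl ℓ) n), ρ.toGaloisRep.IsSemisimple → (∀ᶠ v : IsDedekindDomain.HeightOneSpectrum (NumberField.RingOfIntegers K) in cofinite, SatakeFrobCompatibleAt ι π.1 ρ v) → ρ.toGaloisRep.IsIrreducible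

-- parent: SatakeAvatarExistence · child (gen 4)
/--     item stmt-Langlands-33569 · support · rank 401 · open
    parent: SatakeAvatarExistence · by planner
    why it might fail: Only bookkeeping can fail: the ISOBARIC case (AI(π) not cuspidal when π ≅ π^σ-twist) needs Langlands 1979 Prop 2 / JS 1981 Thm 4.4, untyped in the tree; Henniart's infinity-type fact is typed for CUSPIDAL P only; C- vs L-normalisation half-twist at odd N_j.
    sources: ArthurClozelAMS120, Henniart2012, Clozel1990, HarrisLanTaylorThorneRMS2016, Scholze2015, VarmaFMS2024
[support · PRINT-ASSEMBLABLE, closed modulo named facts · critic rows 105/108: CLEARED as typed ·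
g10: applied to EVERY type-T member it IS the twist family that Q/H consume] SPRAI — for π cuspidal
L-algebraic on GL_n/K at RUNG 0 of the induced-regularity ladder (a cyclic Galois sub-extension K/K₀
with K₀ totally real or CM along which the induced infinity type T_π^{K/K₀} =
InfinityType.automorphicInduction K₀ (n[K:K₀]) T_π is REGULAR) and every (ℓ, ι): the automorphic
induction P = AI_{K/K₀}(π) on GL_{n[K:K₀]}/K₀ EXISTS as a weak automorphic induction
(IsAutomorphicInductionAlong π P, Arthur–Clozel Ch. 3 Def 6.1/Thm 6.2 = tree fact
automorphicInduction_cyclic) AND has a SEMISIMPLE ℓ-adic avatar R : Γ_{K₀} → GL_{n[K:K₀]}(ℚ̄_ℓ)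
Satake–Frobenius compatible with (P, ι) a.e.  Theorem line: automorphicInduction_cyclic +
Henniart2012_infinityType_of_automorphicInduction (P has type T_π^{K/K₀}: regular, L-algebraic by
IsLAlgebraic.automorphicInduction) + Langlands 1979 Prop 2 / Jacquet–Shalika 1981 Thm 4.4 (P is a
constituent of ⊞ P_j induced from cuspidals, Satake and archimedean parameters = unions ⇒ each P_j
regular L-algebraic over the TR/CM field K₀) + exists_galoisRep_of_regularAlge -/
@[route_item "route-Langlands-PrimitiveRankLadder"]
def SpreadInducedAvatar : Prop :=
  ∀ (K : Type) [Field K] [NumberField K] (n : ℕ) (hcpt : Literature.NumberTheory.Automorphic.isCompact_glFiniteIntegralLevel n K), 0 < n → ∀ (π : Literature.NumberTheory.Automorphic.CuspidalAutomorphicRepData n K hcpt), π.1.IsLAlgebraic → ∀ (K₀ : Type) [Field K₀] [NumberField K₀] [Algebra K₀ K], IsGalois K₀ K → IsCyclic (K ≃ₐ[K₀] K) → (NumberField.IsTotallyReal K₀ ∨ NumberField.IsCMField K₀) → ∀ (T : Literature.NumberTheory.Automorphic.InfinityType K n), π.1.HasInfinityType T → (Literature.NumberTheory.Automorphic.InfinityType.automorphicInduction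 K₀ (n * Module.finrank K₀ K) T).IsRegular → ∀ (ℓ : ℕ) [Fact ℓ.Prime] (ι : PadicAlgCl ℓ ≃+* ℂ) (hK₀ : Literature.NumberTheory.Automorphic.isCompact_glFiniteIntegralLevel (n * Module.finrank K₀ K) K₀), ∃ (P : Literature.NumberTheory.Automorphic.AutomorphicRepData (Literature.NumberTheory.Automorphic.AutomorphyDatum.gl (n * Module.finrank K₀ K) K₀ hK₀)) (R : Literature.NumberTheory.GaloisRepresentations.FramedGaloisRep K₀ (PadicAlgCl ℓ) (n * Module.finrank K₀ K)), Literature.NumberTheory.Automorphic.IsAutomorphicInductionAlong π.1 P ∧ R.toGaloisRep.IsSemisimple ∧ ∀ᶠ v : IsDedekindDomain.HeightOneSpectrum (NumberField.RingOfIntegers K₀) in Filter.cofinite, SatakeFrobCompatibleAt ι P R v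

-- parent: SatakeAvatarExistence · child (gen 4)
/--     item stmt-Langlands-33572 · support · rank 404 · open
    parent: SatakeAvatarExistence · by planner
    why it might fail: Routine modulo print (Arthur–Clozel AI, Jacquet–Shalika isobaric classification, Henniart's archimedean types, ⊕ of avatars); the only risk is typing: constituents' types are read through HasInfinityType (L-normalisation; the unitary central twist is absorbed since τ is quantified).
    sources: ArthurClozelAMS120, Henniart2012, JacquetShalika1981, JacquetShalikaAJM1981II, BorelWallach2000, Clozel1990
[support · CLOSED-MOD-PRINT · NEW decl: the literal conjunction (RTT) ∧ (AIT) ∧ (DSS) — replaces TRN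
HullTransport 33424 = (RTT) ∧ (AIT); lens-1-g12 node TowerInductionLadder, `towerTransport_iff :
TRN₃ ↔ RootDecomp1.RestrictionTwistTransport ∧ RootDecomp1.InductionTransport ∧ DarkStepSpread` is
Iff.rfl, `hullTransport_of_towerTransport : TRN₃ → TRN`] TRN₃ — the THREE print transports of the
tower hull HULL₃: (1) RTT (= RootDecomp1 stmt-Langlands-29150 VERBATIM) semisimple ℓ-adic avatars go
UP along an a.e.-twisted weak base change by an L-algebraic character (Arthur–Clozel Ch. 3 +
Serre/Weil); (2) AIT (= 29151 VERBATIM) semisimple avatars go DOWN along automorphic induction (Ind;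
Arthur–Clozel Ch. 3 Def. 6.1/Thm 6.2); (3) DSS DarkStepSpread (NEW text): along a cyclic Galois step
K/K₀ with K₀ an ARBITRARY number field, for an infinity type T on GL_n/K and (ℓ, ι): IF every
cuspidal L-algebraic σ on GL_m/K₀ (0 < m, any compact level) having an infinity type τ that is
POINTWISE A SUB-MULTISET of the induced type (∀ e, τ e ≤ AI_{K/K₀}(T) e) has a semisimple a.e.
Satake–Frobenius avatar over K₀, THEN the type-T twist family over K₀ holds — every cuspidal
L-algebraic π' of type T on GL_n -/
@[route_item "route-Langlands-PrimitiveRankLadder"]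
def TowerTransport : Prop :=
  (∀ (K₀ : Type) [Field K₀] [NumberField K₀] (M : Type) [Field M] [NumberField M] [Algebra K₀ M] (n : ℕ) (h₀ : Literature.NumberTheory.Automorphic.isCompact_glFiniteIntegralLevel n K₀) (hM : Literature.NumberTheory.Automorphic.isCompact_glFiniteIntegralLevel n M) (h₁ : Literature.NumberTheory.Automorphic.isCompact_glFiniteIntegralLevel 1 M), 0 < n → ∀ (π₀ : Literature.NumberTheory.Automorphic.CuspidalAutomorphicRepData n K₀ h₀) (χ : Literature.NumberTheory.Automorphic.AutomorphicRepData (Literature.NumberTheory.Automorphic.AutomorphyDatum.gl 1 M h₁)) (P : Literature.NumberTheory.Automorphic.CuspidalAutomorphicRepData n M hM), π₀.1.IsLAlgebraic → χ.IsLAlgebraic → P.1.IsLAlgebraic → (∀ᶠ w : IsDedekindDomain.HeightOneSpectrum (NumberField.RingOfIntegers M) in cofinite, ∀ (u : IsDedekindDomain.HeightOneSpectrum (NumberField.RingOfIntegers K₀)) (α : Multiset ℂ) (c : ℂ), w.asIdeal.under (NumberField.RingOfIntegers K₀) = u.asIdeal → π₀.1.HasSatakeParamAt u α → χ.HasSatakeParamAt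 w {c} → P.1.HasSatakeParamAt w ((α.map (· ^ w.asIdeal.inertiaDeg (NumberField.RingOfIntegers K₀))).map (c * ·))) → ∀ (ℓ : ℕ) [Fact ℓ.Prime] (ι : PadicAlgCl ℓ ≃+* ℂ) (ρ₀ : Literature.NumberTheory.GaloisRepresentations.FramedGaloisRep K₀ (PadicAlgCl ℓ) n), ρ₀.toGaloisRep.IsSemisimple → (∀ᶠ u : IsDedekindDomain.HeightOneSpectrum (NumberField.RingOfIntegers K₀) in cofinite, SatakeFrobCompatibleAt ι π₀.1 ρ₀ u) → ∃ r : Literature.NumberTheory.GaloisRepresentations.FramedGaloisRep M (PadicAlgCl ℓ) n, r.toGaloisRep.IsSemisimple ∧ ∀ᶠ w : IsDedekindDomain.HeightOneSpectrum (NumberField.RingOfIntegers M) in cofinite, SatakeFrobCompatibleAt ι P.1 r w) ∧ (∀ (K : Type) [Field K] [NumberField K] (L : Type) [Field L] [NumberField L] [Algebra K L] (m n : ℕ) (hL : Literature.NumberTheory.Automorphic.isCompact_glFiniteIntegralLevel m L) (hcpt : Literature.NumberTheory.Automorphic.isCompact_glFiniteIntegralLevel n K), 0 < m → 0 < n → ∀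 (σ : Literature.NumberTheory.Automorphic.CuspidalAutomorphicRepData m L hL) (π : Literature.NumberTheory.Automorphic.CuspidalAutomorphicRepData n K hcpt), σ.1.IsLAlgebraic → π.1.IsLAlgebraic → (∀ᶠ v : IsDedekindDomain.HeightOneSpectrum (NumberField.RingOfIntegers K) in cofinite, ∀ β : IsDedekindDomain.HeightOneSpectrum (NumberField.RingOfIntegers L) → Multiset ℂ, (∀ w : IsDedekindDomain.HeightOneSpectrum (NumberField.RingOfIntegers L), w.asIdeal.under (NumberField.RingOfIntegers K) = v.asIdeal → σ.1.HasSatakeParamAt w (β w)) → ∃ α : Multiset ℂ, π.1.HasSatakeParamAt v α ∧ Literature.NumberTheory.Automorphic.satakePolynomial α = ∏ᶠ w ∈ {w : IsDedekindDomain.HeightOneSpectrum (NumberField.RingOfIntegers L) | w.asIdeal.under (NumberField.RingOfIntegers K) = v.asIdeal}, (Literature.NumberTheory.Automorphic.satakePolynomial (β w)).comp (Polynomial.X ^ w.asIdeal.inertiaDeg (NumberField.RingOfIntegers K))) → ∀ (ℓ : ℕ) [Fact ℓ.Prime] (ι : PadicAlgCl ℓ ≃+* ℂ) (r : Literature.NumberTheory.GaloisRepresentations.FramedGaloisRep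 L (PadicAlgCl ℓ) m), r.toGaloisRep.IsSemisimple → (∀ᶠ w : IsDedekindDomain.HeightOneSpectrum (NumberField.RingOfIntegers L) in cofinite, SatakeFrobCompatibleAt ι σ.1 r w) → ∃ ρ : Literature.NumberTheory.GaloisRepresentations.FramedGaloisRep K (PadicAlgCl ℓ) n, ρ.toGaloisRep.IsSemisimple ∧ ∀ᶠ v : IsDedekindDomain.HeightOneSpectrum (NumberField.RingOfIntegers K) in cofinite, SatakeFrobCompatibleAt ι π.1 ρ v) ∧ (∀ (K : Type) [Field K] [NumberField K] (n : ℕ) (hcpt : Literature.NumberTheory.Automorphic.isCompact_glFiniteIntegralLevel n K), 0 < n → ∀ (K₀ : Type) [Field K₀] [NumberField K₀] [Algebra K₀ K], IsGalois K₀ K → IsCyclic (K ≃ₐ[K₀] K) → ∀ (T : Literature.NumberTheory.Automorphic.InfinityType K n), ∀ (ℓ : ℕ) [Fact ℓ.Prime] (ι : PadicAlgCl ℓ ≃+* ℂ), (∀ (m : ℕ) (hm : Literature.NumberTheory.Automorphic.isCompact_glFiniteIntegralLevel m K₀) (σ : Literature.NumberTheory.Automorphic.CuspidalAutomorphicRepData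 m K₀ hm) (τ : Literature.NumberTheory.Automorphic.InfinityType K₀ m), 0 < m → σ.1.IsLAlgebraic → σ.1.HasInfinityType τ → (∀ e : K₀ →+* ℂ, τ e ≤ (Literature.NumberTheory.Automorphic.InfinityType.automorphicInduction K₀ (n * Module.finrank K₀ K) T) e) → ∃ r : Literature.NumberTheory.GaloisRepresentations.FramedGaloisRep K₀ (PadicAlgCl ℓ) m, r.toGaloisRep.IsSemisimple ∧ ∀ᶠ u : IsDedekindDomain.HeightOneSpectrum (NumberField.RingOfIntegers K₀) in Filter.cofinite, SatakeFrobCompatibleAt ι σ.1 r u) → (∀ (π' : Literature.NumberTheory.Automorphic.CuspidalAutomorphicRepData n K hcpt), π'.1.IsLAlgebraic → π'.1.HasInfinityType T → ∀ (hK₀ : Literature.NumberTheory.Automorphic.isCompact_glFiniteIntegralLevel (n * Module.finrank K₀ K) K₀), ∃ (P : Literature.NumberTheory.Automorphic.AutomorphicRepData (Literature.NumberTheory.Automorphic.AutomorphyDatum.gl (n * Module.finrank K₀ K) K₀ hK₀)) (R : Literature.NumberTheory.GaloisRepresentations.FramedGaloisRep K₀ (PadicAlgCl ℓ) (n * Module.finrank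 K₀ K)), Literature.NumberTheory.Automorphic.IsAutomorphicInductionAlong π'.1 P ∧ R.toGaloisRep.IsSemisimple ∧ ∀ᶠ v : IsDedekindDomain.HeightOneSpectrum (NumberField.RingOfIntegers K₀) in Filter.cofinite, SatakeFrobCompatibleAt ι P R v))

-- parent: SatakeAvatarExistence · glue (gen 4)
/--     item stmt-Langlands-33575 · support · rank 408 · closed · proved by Summit.Langlands.Langlands.Theorems.SatakeAvatarExistence_of_split5_proof (prover)
    parent: SatakeAvatarExistence · GLUE: children ⟹ parent · by planner
SpreadInducedAvatar → QuadraticTwistDescent → HigherInverseInduction → TowerTransport →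
WeaklyRegularHullAvatars → InaccessiblePrimitiveAvatars → CuspidalAvatarIrreducible →
SatakeAvatarExistence — pure logic: excluded middle on the inlined tower-induction-hull membership
of π.1 (on HULL₃: leastness at the class «cuspidal L-algebraic data with a semisimple a.e. avatar
for every (ℓ, ι)» — seed (r0₂) = the rev-6 argument verbatim (excluded middle on the
regular-induction hull: SpreadInducedAvatar over the type-T family + QuadraticTwistDescent on the
box (2,2) / HigherInverseInduction off it, (up)/(ai) by TowerTransport.1/.2.1; off it
WeaklyRegularHullAvatars), (up) by TowerTransport.1, (ai) by TowerTransport.2.1, (ext) the dark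
cyclic step by TowerTransport.2.2 (sub-type avatars ⇒ twist family) then QuadraticTwistDescent /
HigherInverseInduction; then CuspidalAvatarIrreducible); off HULL₃: InaccessiblePrimitiveAvatars;
self-contained proof = nodes/lens-1-g12-TowerInductionLadder.split_glue.lean →
Theorems/PrimitiveRankLadderSatakeAvatarExistenceOfSplit5.lean -/
@[route_item "route-Langlands-PrimitiveRankLadder"]
def SatakeAvatarExistence_of_split5 : Prop :=
  SpreadInducedAvatar → QuadraticTwistDescent → HigherInverseInduction → TowerTransport → WeaklyRegularHullAvatars → InaccessiblePrimitiveAvatars → CuspidalAvatarIrreducible → SatakeAvatarExistence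

-- `SatakeAvatarExistence_of_split5` holds: proved by `Summit.Langlands.Langlands.Theorems.SatakeAvatarExistence_of_split5_proof` (its module imports this route file, so no `_holds` link can be stated here).

/-- item stmt-Langlands-17534 · crux · rank 5 · open · by planner
why it might fail: p-adic local–global compatibility (de Rham-ness and WD-matching at v ∣ ℓ) is known only for regular polarizable / Shimura-type avatars (Caraiani, BLGGT); torsion-class avatars (Scholze) lack it in general.
sources: Caraiani2014, BLGGT2014, ACCGHLNSTT2023
[crux] P — the PRIME-SWITCH PRINCIPLE for the p-adic member of the automorphic compatible system
(Rec-parametric, Rec-free in content; rev 1, cone repair: stated over the summit's own predicates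
only): for π L-algebraic cuspidal on GL_n/K, ρ an irreducible ℓ-adic avatar of (π, ι)
(Satake–Frobenius compatible a.e.) and a place v ∣ ℓ: (i) ρ|_v is de Rham for Fontaine's pinned
datum; (ii) for EVERY reciprocity datum Rec, every prime ℓ' ∤ v, ι' and every irreducible ℓ'-adic
avatar ρ' of (π, ι'), local–global compatibility of (π, ρ') at v for Rec (read ℓ'-adically,
Grothendieck–Deligne) implies local–global compatibility of (π, ρ) at v for Rec (read through
D_pst). Mathematically (ii) is Fontaine's C_WD for the system {ρ_(π,ι)}: the
Frobenius-semisimplified Weil–Deligne representation at v of the p-adic member, computed by D_pst,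
is the common one of the ℓ'-adic members (Saito arXiv:math/0612077 for Hilbert modular forms;
Caraiani 2012/2014 for Shimura varieties; AHTW 2026 Thm 1.2.1 up to semisimplification for regular π
over CM). Kernel-certified consequence of `Langlands` (bc/SubsOfLanglands.lean); with L∤ at (π, ι',
ρ') it is Taylor's Conj. 7 at v ∣ ℓ — the glue's patching lemma. -/
@[route_item "route-Langlands-PrimitiveRankLadder", crux]
def PadicMemberCompatibility : Prop :=
  ∀ (K : Type) [Field K] [NumberField K] (n : ℕ) (hcpt : Literature.NumberTheory.Automorphic.isCompact_glFiniteIntegralLevel n K), 0 < n → ∀ (π : Literature.NumberTheory.Automorphic.CuspidalAutomorphicRepData n K hcpt), π.1.IsLAlgebraic → ∀ (ℓ : ℕ) [Fact ℓ.Prime] (ι : PadicAlgCl ℓ ≃+* ℂ) (ρ : Literature.NumberTheory.GaloisRepresentations.FramedGaloisRep K (PadicAlgCl ℓ) n), ρ.toGaloisRep.IsIrreducible → (∀ᶠ v : IsDedekindDomain.HeightOneSpectrum (NumberField.RingOfIntegers K) in cofinite, SatakeFrobCompatibleAt ι π.1 ρ v) → ∀ (v : IsDedekindDomain.HeightOneSpectrum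 (NumberField.RingOfIntegers K)) (hv : ((ℓ : ℕ) : NumberField.RingOfIntegers K) ∈ v.asIdeal), (Literature.NumberTheory.PAdicHodge.fontainePstAdicCompletion v ℓ hv).IsDeRhamFramed (ρ.toLocal v) ∧ ∀ (Rec : ReciprocityData K) (ℓ' : ℕ) [Fact ℓ'.Prime] (ι' : PadicAlgCl ℓ' ≃+* ℂ) (ρ' : Literature.NumberTheory.GaloisRepresentations.FramedGaloisRep K (PadicAlgCl ℓ') n), ((ℓ' : ℕ) : NumberField.RingOfIntegers K) ∉ v.asIdeal → ρ'.toGaloisRep.IsIrreducible → (∀ᶠ w : IsDedekindDomain.HeightOneSpectrum (NumberField.RingOfIntegers K) in cofinite, SatakeFrobCompatibleAt ι' π.1 ρ' w) → LocalGlobalCompatibleAt Rec ι' π.1 ρ' v → LocalGlobalCompatibleAt Rec ι π.1 ρ v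

/-- item stmt-Langlands-18084 · crux · rank 6 · open · by planner
why it might fail: the monodromy operator at v ∤ ℓ is not controlled by a.e. Satake data for non-Shimura avatars (MonodromyNotClosedUnderPadicLimits); Varma-type results need regular algebraic polarizable π.
sources: Varma2024, TaylorYoshida2007, Caraiani2012
[crux] L∤R — Taylor 2004 Conj. 7 at the places v ∤ ℓ, in the `∀ Rec` form (rev 4, lockstep re-type
after the summit re-type p141787 `∀ F, Nonempty (ReciprocityData F) ∧ ∀ 𝓡 …`): for every number
field K and EVERY reciprocity datum Rec (Henniart-normalised local Langlands data with THE canonical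
Artin pins — the summit's `∀ 𝓡`), every n ≥ 1 and hcpt, every L-algebraic cuspidal π of GL_n(𝔸_K),
every (ℓ, ι) and every IRREDUCIBLE ρ : Γ_K → GL_n(ℚ̄_ℓ) that is pinned-geometric (unramified a.e.,
de Rham above ℓ for Fontaine's pinned datum) and Satake–Frobenius compatible with (π, ι) a.e.:
`LocalGlobalCompatibleAt Rec ι π ρ v` at every finite v ∤ ℓ (Grothendieck–Deligne Weil–Deligne
representation, Frobenius-semisimplified, ↔ rec_v(π_v)). = item L∤ (stmt-Langlands-17417, ∃-Rec
form; verbatim the registered stub `stub_pairCompatibilityAway` of line `Sketch` of crux 14328) with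
Rec moved from `∃ Rec,` to a universal binder after K and nothing else changed; the ∃-form is
implied back by L∤R ∧ CanonicalReciprocityData (`compatibilityAwayFromL_existsForm`).
Kernel-certified consequence of the re-typed summit (`compatibilityAwayFromLR_of_langlands`, planner
bc/SubsOfLanglandsR.lean: direction (A -/
@[route_item "route-Langlands-PrimitiveRankLadder", crux]
def CompatibilityAwayFromLR : Prop :=
  ∀ (K : Type) [Field K] [NumberField K] (Rec : ReciprocityData K) (n : ℕ) (hcpt : Literature.NumberTheory.Automorphic.isCompact_glFiniteIntegralLevel n K), 0 < n → ∀ (π : Literature.NumberTheory.Automorphic.CuspidalAutomorphicRepData n K hcpt), π.1.IsLAlgebraic → ∀ (ℓ : ℕ) [Fact ℓ.Prime] (ι : PadicAlgCl ℓ ≃+* ℂ) (ρ : Literature.NumberTheory.GaloisRepresentations.FramedGaloisRep K (PadicAlgCl ℓ) n), ρ.toGaloisRep.IsIrreducible → ((∀ᶠ v : IsDedekindDomain.HeightOneSpectrum (NumberField.RingOfIntegers K) in cofinite, ρ.IsUnramifiedAt v) ∧ ∀ (v : IsDedekindDomain.HeightOneSpectrum (NumberField.RingOfIntegers K)) (hv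 : ((ℓ : ℕ) : NumberField.RingOfIntegers K) ∈ v.asIdeal), (Literature.NumberTheory.PAdicHodge.fontainePstAdicCompletion v ℓ hv).IsDeRhamFramed (ρ.toLocal v)) → (∀ᶠ v : IsDedekindDomain.HeightOneSpectrum (NumberField.RingOfIntegers K) in cofinite, SatakeFrobCompatibleAt ι π.1 ρ v) → ∀ v : IsDedekindDomain.HeightOneSpectrum (NumberField.RingOfIntegers K), ((ℓ : ℕ) : NumberField.RingOfIntegers K) ∉ v.asIdeal → LocalGlobalCompatibleAt Rec ι π.1 ρ v

/-- item stmt-Langlands-17930 · support · rank 9 · open · by planner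
sources: HarrisTaylor2001, Fontaine1994
[support] THE SUMMIT'S NON-VACUITY CONJUNCT, verbatim (statement revision p141787, 2026-08-17:
`Langlands := ∀ F, Nonempty (ReciprocityData F) ∧ ∀ 𝓡 n, 0 < n → ∀ hcpt, GLC n F 𝓡 hcpt`, with
`ReciprocityData` pinned to THE local Artin maps by `llc_isCanonical` / `llc_eps_isCanonical`),
filed by route-repair 5a1bd9af as the explicit INPUT of this route's `∃ RD`-shaped slices
(LiftB2Unram, LiftB2UnramSmallF, LiftB2UnramLargeF, LiftB2UnramSplitP): for every number field F and
every finite place v, a local Langlands datum for GL_n(F_v) (Harris–Taylor 2001 Thm A; Henniart 2000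
Thm 1.2) normalised against THE local Artin map `canonicalArtin (F_v)`, whose ε-system (Deligne 1973
Thm 4.1) is normalised against the canonical Artin map of every finite E/F_v. IN PRINT,
textbook-grade input (Harris–Taylor's Thm A is stated relative to Art_K of local class field
theory); in the TREE not yet derivable — `LocalLanglandsDatum.nonempty` (cite-only) yields a datum
with SOME lawful Artin normalisation, and canonicity needs `IsLocalArtinMap.unique` + the
finite-level reciprocity law for that datum's Artin maps, or canonical variants of
`localLanglands_gl` / `nonempty_localEpsilonSystem` (needs-fact for -/
@[route_item "route-Langlands-PrimitiveRankLadder", crux]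
def CanonicalReciprocityData : Prop :=
  ∀ (F : Type) [Field F] [NumberField F], Nonempty (Summit.Langlands.ReciprocityData F)

/-- item stmt-Langlands-24805 · support · rank 9 · open · by planner
sources: Serre1968AbelianEllAdic, Weil1956Hecke
[support] Grade 1 of the ladder: every (irreducible) pinned-geometric ℓ-adic character of Γ_K is
weakly automorphic (an L-algebraic Hecke character matching a.e.). Verbatim the registered
stub_rankOne (Cruxes/SectorComplement/Lines/birth_WeakGeometricAutomorphy.lean); print: class field
theory + Weil 1956 + Serre 1968 III.2.3 + abelian Fontaine–Mazur. TAGS: WEAKER · PRINT ·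
ATTACKABLE[closed-mod-print; = the registered `stub_rankOne` verbatim — one proof closes both].
[difficulty: provable-now] -/
@[route_item "route-Langlands-PrimitiveRankLadder", crux]
def RankOneAutomorphy : Prop :=
  ∀ (K : Type) [Field K] [NumberField K] (hcpt : Literature.NumberTheory.Automorphic.isCompact_glFiniteIntegralLevel 1 K) (ℓ : ℕ) [Fact ℓ.Prime] (ι : PadicAlgCl ℓ ≃+* ℂ) (ρ : Literature.NumberTheory.GaloisRepresentations.FramedGaloisRep K (PadicAlgCl ℓ) 1), ρ.toGaloisRep.IsIrreducible → ((∀ᶠ v : IsDedekindDomain.HeightOneSpectrum (NumberField.RingOfIntegers K) in cofinite, ρ.IsUnramifiedAt v) ∧ ∀ (v : IsDedekindDomain.HeightOneSpectrum (NumberField.RingOfIntegers K)) (hv : ((ℓ : ℕ) : NumberField.RingOfIntegers K) ∈ v.asIdeal), (Literature.NumberTheory.PAdicHodge.fontainePstAdicCompletion v ℓ hv).IsDeRhamFramed (ρ.toLocal v)) → ∃ π : Literature.NumberTheory.Automorphic.CuspidalAutomorphicRepData 1 K hcpt, π.1.IsLAlgebraic ∧ ∀ᶠ v : IsDedekindDomain.HeightOneSpectrum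 (NumberField.RingOfIntegers K) in cofinite, SatakeFrobCompatibleAt ι π.1 ρ v

/-- item stmt-Langlands-24806 · support · rank 9 · open · by planner
sources: ArthurClozel1989, Henniart2012
[support] The inductive step of the ladder, isolated: for an irreducible pinned-geometric ρ of rank
n ≥ 2 WITH a self-twist, weak automorphy at all ranks m < n (over all number fields) implies weak
automorphy of ρ — Clifford (ρ ≅ Ind_E σ, E/K cyclic of prime degree) + cyclic automorphic induction
in Satake form (Arthur–Clozel Ch. 3 Thm 6.2, Lemma 6.4; Henniart 2012 at ∞); tree facts
automorphicInduction_cyclic_cuspidal(_unramified),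
Henniart2012_infinityType_of_automorphicInduction,
ArthurClozel1989_automorphicInduction_of_selfTwist,
FramedGaloisRep.nonempty_equiv_of_hasFrobCharpolyAt_eventually. TAGS: WEAKER · PRINT (given all
lower grades) · ATTACKABLE[closed-mod-print: theorem
`FramedGaloisRep.nonempty_equiv_of_hasFrobCharpolyAt_eventually` (Chebotarev–Brauer–Nesbitt),
Clifford, the AI Prop-facts and Henniart's archimedean theorems named above]. [difficulty: M] -/
@[route_item "route-Langlands-PrimitiveRankLadder", crux]
def CyclicInductionTransport : Prop :=
  ∀ (K : Type) [Field K] [NumberField K] (n : ℕ) (hcpt : Literature.NumberTheory.Automorphic.isCompact_glFiniteIntegralLevel n K), 2 ≤ n → ∀ (ℓ : ℕ) [Fact ℓ.Prime] (ι : PadicAlgCl ℓ ≃+* ℂ) (ρ : Literature.NumberTheory.GaloisRepresentations.FramedGaloisRep K (PadicAlgCl ℓ) n), ρ.toGaloisRep.IsIrreducible → ((∀ᶠ v : IsDedekindDomain.HeightOneSpectrum (NumberField.RingOfIntegers K) in Filter.cofinite, ρ.IsUnramifiedAt v) ∧ ∀ (v : IsDedekindDomain.HeightOneSpectrum (NumberField.RingOfIntegers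 K)) (hv : ((ℓ : ℕ) : NumberField.RingOfIntegers K) ∈ v.asIdeal), (Literature.NumberTheory.PAdicHodge.fontainePstAdicCompletion v ℓ hv).IsDeRhamFramed (ρ.toLocal v)) → (∃ η : Literature.NumberTheory.GaloisRepresentations.FramedGaloisRep K (PadicAlgCl ℓ) 1, (∃ᶠ v : IsDedekindDomain.HeightOneSpectrum (NumberField.RingOfIntegers K) in Filter.cofinite, ∃ a : PadicAlgCl ℓ, a ≠ 1 ∧ η.HasFrobCharpolyAt v (Polynomial.X - Polynomial.C a)) ∧ ∀ᶠ v : IsDedekindDomain.HeightOneSpectrum (NumberField.RingOfIntegers K) in Filter.cofinite, ∃ (P : Polynomial (PadicAlgCl ℓ)) (a : PadicAlgCl ℓ), ρ.HasFrobCharpolyAt v P ∧ η.HasFrobCharpolyAt v (Polynomial.X - Polynomial.C a) ∧ P.scaleRoots a = P) → (∀ m : ℕ, m < n → ∀ (E : Type) [Field E] [NumberField E] (hE : Literature.NumberTheory.Automorphic.isCompact_glFiniteIntegralLevel m E), 0 < m → ∀ (ℓ' : ℕ) [Fact ℓ'.Prime] (ι' : PadicAlgCl ℓ' ≃+* ℂ)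 (σ : Literature.NumberTheory.GaloisRepresentations.FramedGaloisRep E (PadicAlgCl ℓ') m), σ.toGaloisRep.IsIrreducible → ((∀ᶠ v : IsDedekindDomain.HeightOneSpectrum (NumberField.RingOfIntegers E) in Filter.cofinite, σ.IsUnramifiedAt v) ∧ ∀ (v : IsDedekindDomain.HeightOneSpectrum (NumberField.RingOfIntegers E)) (hv : ((ℓ' : ℕ) : NumberField.RingOfIntegers E) ∈ v.asIdeal), (Literature.NumberTheory.PAdicHodge.fontainePstAdicCompletion v ℓ' hv).IsDeRhamFramed (σ.toLocal v)) → ∃ π : Literature.NumberTheory.Automorphic.CuspidalAutomorphicRepData m E hE, π.1.IsLAlgebraic ∧ ∀ᶠ v : IsDedekindDomain.HeightOneSpectrum (NumberField.RingOfIntegers E) in Filter.cofinite, SatakeFrobCompatibleAt ι' π.1 σ v) → ∃ π : Literature.NumberTheory.Automorphic.CuspidalAutomorphicRepData n K hcpt, π.1.IsLAlgebraic ∧ ∀ᶠ v : IsDedekindDomain.HeightOneSpectrum (NumberField.RingOfIntegers K) in Filter.cofinite, SatakeFrobCompatibleAt ι π.1 ρ v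

/-- item stmt-Langlands-24807 · assembly · rank 1 · open · by planner
sources: ArthurClozel1989
[assembly] RankOneAutomorphy → RankTwoPrimitiveAutomorphy → HigherRankPrimitiveAutomorphy →
CyclicInductionTransport → SatakeAvatarExistence → PadicMemberCompatibility →
CompatibilityAwayFromLR → CanonicalReciprocityData → Langlands -/
@[route_item "route-Langlands-PrimitiveRankLadder"]
def Assembly : Prop :=
  RankOneAutomorphy → RankTwoPrimitiveAutomorphy → HigherRankPrimitiveAutomorphy → CyclicInductionTransport → SatakeAvatarExistence → PadicMemberCompatibility → CompatibilityAwayFromLR → CanonicalReciprocityData → _root_.Langlands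

/-! D-0027 §2.1 — DECIDING THEOREM (planner-authored via `route open/edit --closes-file`; by planner-decomp-langlands-writer-1-g0-0 2026-08-30T02:05:02Z):
its hypotheses are this route's items and its conclusion the sub-problem Statement (glue_lint), and it elaborates with this file. -/

/- (spliced by the gate into the rendered route file via `--closes-file`; not a standalone module — certified by
   `ledger route check --native route.json --closes-file glue.lean`: verdict OK)
   D-0027 §2.1 deciding theorem for route PrimitiveRankLadder (decomp-langlands lens-1 gen 0; filed by writer-1 gen 0).
   Self-contained: works over the INLINED one-liner items (no helper lemmas). Level 2 = B_w at every rank by strong induction on n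
   (n = 1: RankOneAutomorphy; self-twist & n ≥ 2: CyclicInductionTransport fed by the induction hypothesis; twist-primitive n = 2 /
   n ≥ 3: the two cruxes); level 1 = N0's assembly (prime switch ℓ' ∈ {2,3} + avatar transport), verbatim the frame of record. -/
@[closes "route-Langlands-PrimitiveRankLadder"] theorem closes (h1 : RankOneAutomorphy) (h2 : RankTwoPrimitiveAutomorphy) (h3 : HigherRankPrimitiveAutomorphy)
    (hT : CyclicInductionTransport) (hW : SatakeAvatarExistence) (hP : PadicMemberCompatibility)
    (hA : CompatibilityAwayFromLR) (hR : CanonicalReciprocityData) : _root_.Langlands := by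
  -- `Assembly` (item) is literally the curried form of this theorem: prove it, then apply it
  -- (pulls the Assembly item into the cone of `closes`; writer convention of RootDecomp1 / ResidualSplit / WeightMultiplicitySplit).
  suffices hAsm : Assembly from hAsm h1 h2 h3 hT hW hP hA hR
  clear h1 h2 h3 hT hW hP hA hR
  intro h1 h2 h3 hT hW hP hA hR
  -- U = N0 item stmt-Langlands-17844, PROVED in the tree (Chebotarev + Brauer–Nesbitt; Deligne–Serre Lemme 3.2):
  -- consumed as the landed theorem, not re-filed as an item.
  have hU := @_root_.Summit.Langlands.Langlands.Theorems.EisensteinDegreeShiftSectorComplement.stub_avatarConjugacy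
  -- LEVEL 2: weak geometric automorphy at every rank (strong induction on the rank)
  have hAll : ∀ n : ℕ, ∀ (E : Type) [Field E] [NumberField E] (hE : Literature.NumberTheory.Automorphic.isCompact_glFiniteIntegralLevel n E), 0 < n → ∀ (ℓ' : ℕ) [Fact ℓ'.Prime] (ι' : PadicAlgCl ℓ' ≃+* ℂ) (σ : Literature.NumberTheory.GaloisRepresentations.FramedGaloisRep E (PadicAlgCl ℓ') n), σ.toGaloisRep.IsIrreducible → ((∀ᶠ v : IsDedekindDomain.HeightOneSpectrum (NumberField.RingOfIntegers E) in Filter.cofinite, σ.IsUnramifiedAt v) ∧ ∀ (v : IsDedekindDomain.HeightOneSpectrum (NumberField.RingOfIntegers E)) (hv : ((ℓ' : ℕ) : NumberField.RingOfIntegers E) ∈ v.asIdeal), (Literature.NumberTheory.PAdicHodge.fontainePstAdicCompletion v ℓ' hv).IsDeRhamFramed (σ.toLocal v)) → ∃ π : Literature.NumberTheory.Automorphic.CuspidalAutomorphicRepData n E hE, π.1.IsLAlgebraic ∧ ∀ᶠ v : IsDedekindDomain.HeightOneSpectrum (NumberField.RingOfIntegers E) in Filter.cofinite, SatakeFrobCompatibleAt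 ι' π.1 σ v := by
    intro n
    induction n using Nat.strong_induction_on with
    | _ n ih =>
      intro K _ _ hcpt hn ℓ _ ι ρ hirr hgeo
      by_cases htw : (∃ η : Literature.NumberTheory.GaloisRepresentations.FramedGaloisRep K (PadicAlgCl ℓ) 1, (∃ᶠ v : IsDedekindDomain.HeightOneSpectrum (NumberField.RingOfIntegers K) in Filter.cofinite, ∃ a : PadicAlgCl ℓ, a ≠ 1 ∧ η.HasFrobCharpolyAt v (Polynomial.X - Polynomial.C a)) ∧ ∀ᶠ v : IsDedekindDomain.HeightOneSpectrum (NumberField.RingOfIntegers K) in Filter.cofinite, ∃ (P : Polynomial (PadicAlgCl ℓ)) (a : PadicAlgCl ℓ), ρ.HasFrobCharpolyAt v P ∧ η.HasFrobCharpolyAt v (Polynomial.X - Polynomial.C a) ∧ P.scaleRoots a = P)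
      · rcases Nat.lt_or_ge n 2 with hlt | hge
        · obtain rfl : n = 1 := by omega
          exact h1 K hcpt ℓ ι ρ hirr hgeo
        · exact hT K n hcpt hge ℓ ι ρ hirr hgeo htw (fun m hm => ih m hm)
      · rcases (show n = 1 ∨ n = 2 ∨ 3 ≤ n by omega) with h | h | h
        · subst h; exact h1 K hcpt ℓ ι ρ hirr hgeo
        · subst h; exact h2 K hcpt ℓ ι ρ hirr hgeo htw
        · exact h3 K n hcpt h ℓ ι ρ hirr hgeo htw
  have hB : ∀ (K : Type) [Field K] [NumberField K] (n : ℕ) (hcpt : Literature.NumberTheory.Automorphic.isCompact_glFiniteIntegralLevel n K), 0 < n → ∀ (ℓ : ℕ) [Fact ℓ.Prime] (ι : PadicAlgCl ℓ ≃+* ℂ) (ρ : Literature.NumberTheory.GaloisRepresentations.FramedGaloisRep K (PadicAlgCl ℓ) n), ρ.toGaloisRep.IsIrreducible → ((∀ᶠ v : IsDedekindDomain.HeightOneSpectrum (NumberField.RingOfIntegers K) in Filter.cofinite, ρ.IsUnramifiedAt v) ∧ ∀ (v : IsDedekindDomain.HeightOneSpectrum (NumberField.RingOfIntegers K)) (hv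 : ((ℓ : ℕ) : NumberField.RingOfIntegers K) ∈ v.asIdeal), (Literature.NumberTheory.PAdicHodge.fontainePstAdicCompletion v ℓ hv).IsDeRhamFramed (ρ.toLocal v)) → ∃ π : Literature.NumberTheory.Automorphic.CuspidalAutomorphicRepData n K hcpt, π.1.IsLAlgebraic ∧ ∀ᶠ v : IsDedekindDomain.HeightOneSpectrum (NumberField.RingOfIntegers K) in Filter.cofinite, SatakeFrobCompatibleAt ι π.1 ρ v :=
    fun K _ _ n hcpt hn ℓ _ ι ρ hirr hgeo => hAll n K hcpt hn ℓ ι ρ hirr hgeo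
  -- LEVEL 1: the frame of record (N0 = PrimeSwitchSplit rev 4)
  intro F _ _
  refine ⟨hR F, fun Rec n hn hcpt => ?_⟩
  have hRec := hA F Rec
  have hprime : ∀ v : IsDedekindDomain.HeightOneSpectrum (NumberField.RingOfIntegers F),
      ∃ (ℓ' : ℕ) (_ : Fact ℓ'.Prime), ((ℓ' : ℕ) : NumberField.RingOfIntegers F) ∉ v.asIdeal := by
    intro v
    by_cases h2 : ((2 : ℕ) : NumberField.RingOfIntegers F) ∈ v.asIdeal
    · refine ⟨3, ⟨Nat.prime_three⟩, fun h3 => v.isPrime.ne_top ((Ideal.eq_top_iff_one _).2 ?_)⟩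
      have h := v.asIdeal.sub_mem h3 h2
      have h1 : ((3 : ℕ) : NumberField.RingOfIntegers F) - ((2 : ℕ) : NumberField.RingOfIntegers F) = 1 := by
        push_cast; norm_num
      rwa [h1] at h
    · exact ⟨2, ⟨Nat.prime_two⟩, h2⟩
  have hLGC : ∀ (π : Literature.NumberTheory.Automorphic.CuspidalAutomorphicRepData n F hcpt), π.1.IsLAlgebraic →
      ∀ (ℓ : ℕ) [Fact ℓ.Prime] (ι : PadicAlgCl ℓ ≃+* ℂ)
        (ρ : Literature.NumberTheory.GaloisRepresentations.FramedGaloisRep F (PadicAlgCl ℓ) n),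
        ρ.toGaloisRep.IsIrreducible →
        (∀ᶠ v : IsDedekindDomain.HeightOneSpectrum (NumberField.RingOfIntegers F) in Filter.cofinite,
          SatakeFrobCompatibleAt ι π.1 ρ v) →
        IsGeometricFramed Rec ρ ∧
          ∀ v : IsDedekindDomain.HeightOneSpectrum (NumberField.RingOfIntegers F),
            LocalGlobalCompatibleAt Rec ι π.1 ρ v := by
    intro π hL ℓ _ ι ρ hirr hρ
    have hgeo : (∀ᶠ v : IsDedekindDomain.HeightOneSpectrum (NumberField.RingOfIntegers F) in Filter.cofinite,
        ρ.IsUnramifiedAt v) ∧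
        ∀ (v : IsDedekindDomain.HeightOneSpectrum (NumberField.RingOfIntegers F))
          (hv : ((ℓ : ℕ) : NumberField.RingOfIntegers F) ∈ v.asIdeal),
          (Literature.NumberTheory.PAdicHodge.fontainePstAdicCompletion v ℓ hv).IsDeRhamFramed
            (ρ.toLocal v) :=
      ⟨hρ.mono fun v ⟨_, _, hur, _⟩ => hur, fun v hv => (hP F n hcpt hn π hL ℓ ι ρ hirr hρ v hv).1⟩
    refine ⟨hgeo, fun v => ?_⟩
    by_cases hv : ((ℓ : ℕ) : NumberField.RingOfIntegers F) ∈ v.asIdeal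
    · obtain ⟨ℓ', _, hℓ'⟩ := hprime v
      obtain ⟨ι'⟩ := PadicAlgCl.nonempty_ringEquiv_complex ℓ'
      obtain ⟨ρ', hirr', hρ'⟩ := hW F n hcpt hn π hL ℓ' ι'
      have hgeo' : (∀ᶠ w : IsDedekindDomain.HeightOneSpectrum (NumberField.RingOfIntegers F) in Filter.cofinite,
          ρ'.IsUnramifiedAt w) ∧
          ∀ (w : IsDedekindDomain.HeightOneSpectrum (NumberField.RingOfIntegers F))
            (hw : ((ℓ' : ℕ) : NumberField.RingOfIntegers F) ∈ w.asIdeal),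
            (Literature.NumberTheory.PAdicHodge.fontainePstAdicCompletion w ℓ' hw).IsDeRhamFramed
              (ρ'.toLocal w) :=
        ⟨hρ'.mono fun w ⟨_, _, hur, _⟩ => hur,
          fun w hw => (hP F n hcpt hn π hL ℓ' ι' ρ' hirr' hρ' w hw).1⟩
      exact (hP F n hcpt hn π hL ℓ ι ρ hirr hρ v hv).2 Rec ℓ' ι' ρ' hℓ' hirr' hρ'
        (hRec n hcpt hn π hL ℓ' ι' ρ' hirr' hgeo' hρ' v hℓ')
    · exact hRec n hcpt hn π hL ℓ ι ρ hirr hgeo hρ v hv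
  refine ⟨?_, ?_⟩
  · intro π hL ℓ _ ι
    obtain ⟨ρ, hirr, hρ⟩ := hW F n hcpt hn π hL ℓ ι
    obtain ⟨hgeo, hloc⟩ := hLGC π hL ℓ ι ρ hirr hρ
    exact ⟨ρ, hirr, hgeo, ⟨hρ, hloc⟩, fun ρ' h' => hU F n hcpt π ℓ ι ρ ρ' hirr hρ h'.1⟩
  · intro ℓ _ ι ρ hirr hgeo
    obtain ⟨π, hL, hρ⟩ := hB F n hcpt hn ℓ ι ρ hirr hgeo
    exact ⟨π, hL, hρ, (hLGC π hL ℓ ι ρ hirr hρ).2⟩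

end Summit.Langlands.Langlands.Theses.PrimitiveRankLadder
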